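import Literature.Probability.Percolation.MarkedLoopTripodRank
import Literature.Probability.Percolation.MarkedLoopFanBoundary
import HarnessLib

/-!
# The tripod law solved: a depth recursion with free data on the outermost patterns

Topic `Literature/Probability/Percolation`; generic-`k` layer, a rider on `MarkedLoopHolomorphy.lean` (the TRIPOD LAW `TripodLaw`
for class weights `wt : Fin k → Finset (Fin k × Fin k) → ℂ`, tripod pictures `TripodPicture`, `withPair`; ★ `holomorphicW_of_tripodLaw`:
the tripod law implies discrete holomorphicity of the class-weighted `k`-disorder observable on every `k`-marked domain) and on
`MarkedLoopTripodRank.lean` (`depth`). Khristoforov–Smirnov prove their Lemma 4 for `k = 3` with the weight `τ^j`; the tree's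
`holomorphicW_fan` gives ONE explicit solution of the tripod law for every odd `k`. THIS FILE DESCRIBES ALL SOLUTIONS.

## Content (every `k`; no lattice — pure combinatorics of non-crossing patterns)
* `IsPattern j L` — a (partner, link relation) PATTERN: `L` symmetric, irreflexive, avoiding `j`, perfect on the other corners and
  NON-CROSSING (`CcwQuad`-planar), the shape of `(partner ξ, linkRel ξ)` of a configuration (tree: `reLinkingK_holds`,
  `false_of_interleaved_links`); `encl j L` — the pairs `(c, d) ∈ L` with `c < j < d` (`depth j L = #encl j L`);
  `innerPair j L = (α, γ)` — the INNERMOST enclosing chord (largest `c`); `strip L α γ = L ∖ {(α,γ),(γ,α)}`;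
  the two DESCENTS of a pattern of positive depth: `loDesc j L = (α; strip + {j,γ})`, `hiDesc j L = (γ; strip + {α,j})`.
* ★ `tripodPicture_of_pattern` — a pattern of positive depth IS the mid pattern of the increasing tripod picture `(α, j, γ; strip)`;
  `TripodPicture.isPattern_lo` — the three patterns of a picture are patterns; `innerPair_midPat`, `loDesc_midPat`, `hiDesc_midPat` —
  the descents of the mid pattern of an increasing picture are its lo and hi patterns; `depth_loDesc`, `depth_hiDesc` (depth drops by one).
* ★★ `tripodLaw_iff_rec` — THE TRIPOD LAW IS A RECURSION IN THE DEPTH: `TripodLaw wt ↔` for every pattern of positive depth,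
  `wt j L = −τ²·wt (loDesc j L) − τ·wt (hiDesc j L)`.
* ★★★ `Pat k`, `Pat.lo`, `Pat.hi`, `solW k` (the solution space as a `ℂ`-submodule of `Pat k → ℂ`), `extend φ` (the solution with
  prescribed values on the depth-`0` patterns, by well-founded recursion), `extend_mem_solW`, `eq_extend_of_mem_solW` (uniqueness),
  `solWEquiv : solW k ≃ₗ[ℂ] (Pat₀ k → ℂ)` (restriction to the OUTERMOST patterns `Pat₀ k` = depth `0` = the partner is enclosed by no
  chord), ★ `finrank_solW : finrank ℂ (solW k) = Fintype.card (Pat₀ k)`.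
* ★★ `tripodLaw_iff_restrict_mem_solW` — `TripodLaw wt ↔ (wt restricted to patterns) ∈ solW k`; `tripodLaw_classWt`,
  `holomorphicW_classWt`, `holomorphicW_extend` — for EVERY `φ : Pat₀ k → ℂ` the class weight `classWt (extend φ)` is a tripod-law
  weight, hence (tree `holomorphicW_of_tripodLaw`) its class-weighted `k`-disorder observable is discretely holomorphic on every
  `k`-marked domain; `restrictW_eq_extend_of_tripodLaw` (every tripod-law weight arises so, on the patterns);
  `restrictW_fanWt_mem_solW` (the tree's fan weight, `tripodLaw_fan`, is one member).
* ★★ `IsNCMatching`, `NCMatching n` (non-crossing perfect matchings = link patterns of `n` points), `closeUpRel` / `lowerRel`,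
  `isNCMatching_closeUpRel`, `isPattern_lowerRel`, `depth_lowerRel`, `pat₀EquivNCMatching k : Pat₀ k ≃ NCMatching (k+1)` (close the
  partner up to a new last point), ★★★ `finrank_solW_eq_card_ncMatching : finrank ℂ (solW k) = Fintype.card (NCMatching (k+1))`.
* ★★ `basisW q = extend δ_q` (the BASIS solution of an outermost pattern), `basisW_of_zero`, `holomorphicW_basisW`, ★ `eq_sum_basisW_of_mem_solW`
  (every solution is `Σ_q w(q)·basisW q`), `rainbow l` (the outermost pattern `(0; {i, 2l+1−i})`), ★★ `restrictW_fanWt_eq_neg_basisW`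
  (THE TREE'S FAN WEIGHT IS `−basisW (rainbow l)` on the patterns).
* ★ `Pic.toPat` / `Pat.toPic` / `picEquivPosDepth k : Pic k ≃ {p : Pat k // 0 < p.pdepth}` (the pictures of `MarkedLoopTripodRank` ARE the
  patterns of positive depth), `card_pat_eq_card_pat₀_add_card_pic` (`#Pat = #Pat₀ + #Pic`), ★★ `finrank_solW_add_card_pic`
  (dimension + #relations = #unknowns).
* `solWBasis k : Module.Basis (Pat₀ k) ℂ (solW k)` (Mathlib basis object; `coe_solWBasis`: its vectors are the `basisW q`), `finrank_solW_pos`.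
* ★★ `descendN` / `coefN` / `eq_sum_descendN` (THE RECURSION UNROLLED: `w p = Σ_{ε : Fin n → Bool} coefN ε · w (descendN n p ε)` over the `2^n`
  descent words, `n = depth p`), ★ `basisW_eq_sum_descendN` (closed form of the basis: the signed `τ`-powers of the words from `p` ending at `q`).
* ★★ `Encl`, `frozen_loDesc` / `frozen_hiDesc` / `frozen_descendN` (a chord not enclosing the partner is FROZEN along every descent), `created_loDesc` /
  `created_hiDesc`, ★★ `descendN_injective` (DISTINCT WORDS REACH DISTINCT PATTERNS), ★ `basisW_eq_zero_or_coefN` (the closed form has AT MOST ONE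
  TERM: `basisW q p = 0` or `= coefN ε` for the unique word `ε` from `p` to `q` — a signed power of `τ`).


## ONE-CAR EDITION (ed.7 = «TRIPOD-SOLVED»): this module also carries the former HOME cars «BASIS-BVP» (ed.5 51464a6f01a5ebcd) and «TRIPOD-K3»
(ed.1 af50b1e0a35bface) verbatim as its last two parts (lead g14 r17-style merge: one olean wait instead of three; cells carry BY NAME):
* Part BVP — `isPattern_linkRel` (the link relation of every loop configuration is a pattern), the ARC LAW `encl_iff_encl_gap_of_boundary`,
  the HOME-ARC LAW `gkW/obsW_basis_boundary_last`, `obsW_eq_sum_outermost` (every tripod-law observable = Σ_q wt(q)·basis observable),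
  `patternCount` / `obsW_classWt_eq_sum_patternCount` (pattern-count expansion) / `patternCount_eq_zero_of_boundary`; imports the tree's
  `MarkedLoopFanBoundary` for `false_of_chord_separates`.
* Part K3 — worked example k = 3: `pat₀_three`, `restrictW_tau_pow_eq` (Khristoforov–Smirnov's weight τ^j = basisW (rainbow 1) + τ²·basisW q₂).

## Remarks (bookkeeping, not used by the proofs)
* For `k = 2l+1` the number of link patterns of `k+1 = 2l+2` points is the Catalan number `C_{l+1}` (2, 5, 14, 42, 132 for
  k = 3, 5, 7, 9, 11; the lane's exact tables) — the dimension of the Temperley–Lieb standard module / of the Flores–Kleban solution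
  space for `k+1` points; the Catalan VALUE is not evaluated in this file. CONSISTENCY REMARK ONLY: nothing about convergence of
  lattice observables to continuum objects is claimed or suggested here. `finrank_solW_add_card_pic` gives the dimension also as
  `#patterns − #pictures`, consistent with `MarkedLoopTripodRank` (`linearIndependent_relVec`: the relations are independent).
* `basisW_eq_sum_descendN` + `descendN_injective` give the closed form `basisW q p ∈ {0} ∪ {coefN ε}` (`basisW_eq_zero_or_coefN`), matching the
  lane's exact tables for k ≤ 9 (`numerics/basis_check.py`).

## References
* M. Khristoforov, S. Smirnov, *Percolation and O(1) loop model*, arXiv:2111.15612 (2021), §1.2 (arXiv v1 p. 2: the link pattern,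
  «IP(ξ) is a union of disjoint paths, matching marked points»), §2 Lemma 4 and Fig. 3 (p. 4: «each triple contributes zero»).
* B. Bollobás, O. Riordan, *Percolation*, CUP (2006), Ch. 7 §7.2.2 (pp. 191–195) (marked discrete domains).
-/

open Finset

namespace Literature.Probability.Percolation.MarkedLoops

open Literature.Probability.Percolation.FivePoint (tau)

/-! ### Cyclic-order helpers -/

section CcwHelpers

variable {nm : ℕ}

/-- an anticlockwise quadruple has pairwise distinct consecutive entries. [folklore] -/
private theorem ccwQuad_ne {x y z w : Fin nm} (h : CcwQuad x y z w) : x ≠ y ∧ y ≠ z ∧ z ≠ w ∧ w ≠ x ∧ x ≠ z ∧ y ≠ w := by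
  unfold CcwQuad at h
  simp only [Fin.lt_def] at h
  refine ⟨?_, ?_, ?_, ?_, ?_, ?_⟩ <;> intro e <;> have := congrArg Fin.val e <;> omega

/-- anticlockwise quadruples rotate. [folklore] -/
private theorem ccwQuad_rot {x y z w : Fin nm} : CcwQuad x y z w ↔ CcwQuad y z w x := by
  unfold CcwQuad; tauto

/-- the chords of a tripod (the tree's private `mem_chords`, restated). [folklore] -/
private theorem mem_chords' {α β γ : Fin nm} {L₀ : Finset (Fin nm × Fin nm)} {x z : Fin nm} :
    (x, z) ∈ withPair (withPair (withPair L₀ α β) β γ) γ α ↔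
      (x = γ ∧ z = α) ∨ (x = α ∧ z = γ) ∨ (x = β ∧ z = γ) ∨ (x = γ ∧ z = β) ∨ (x = α ∧ z = β) ∨ (x = β ∧ z = α) ∨ (x, z) ∈ L₀ := by
  rw [mem_withPair, mem_withPair, mem_withPair]

/-- `τ³ = 1`. [folklore] -/
private theorem tau_pow_three' : tau ^ 3 = 1 := by
  unfold tau
  rw [← Complex.exp_nat_mul]
  have : ((3 : ℕ) : ℂ) * (2 * Real.pi * Complex.I / 3) = 2 * Real.pi * Complex.I := by push_cast; ring
  rw [this, Complex.exp_two_pi_mul_I]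

end CcwHelpers

/-! ### Patterns -/

section Patterns

variable {nm : ℕ}

/-- **a (partner, link relation) PATTERN**: the relation `L` on the corners is symmetric, irreflexive, avoids the partner `j`, is
perfect on the other corners (each has exactly one partner) and NON-CROSSING — the shape of `(partner, linkRel)` of a loop
configuration with disorders at the `k` corners and at an interior mid-edge.
[cite: KhristoforovSmirnov2021, §1.2 (arXiv v1 p. 2: «IP(ξ) is a union of disjoint paths, matching marked points»)] -/
structure IsPattern (j : Fin nm) (L : Finset (Fin nm × Fin nm)) : Prop where
  symm : ∀ a b, (a, b) ∈ L → (b, a) ∈ L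
  irrefl : ∀ a, (a, a) ∉ L
  off : ∀ a b, (a, b) ∈ L → a ≠ j
  perfect : ∀ a, a ≠ j → ∃! b, (a, b) ∈ L
  planar : ∀ x y z w, (x, z) ∈ L → (y, w) ∈ L → ¬ CcwQuad x y z w

namespace IsPattern

variable {j : Fin nm} {L : Finset (Fin nm × Fin nm)} (hP : IsPattern j L)
include hP

/-- the second entry of a pair avoids the partner too. [cite: KhristoforovSmirnov2021, §1.2 (arXiv v1 p. 2)] -/
theorem off₂ {a b : Fin nm} (h : (a, b) ∈ L) : b ≠ j := hP.off b a (hP.symm a b h)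

/-- the entries of a pair are distinct. [cite: KhristoforovSmirnov2021, §1.2 (arXiv v1 p. 2)] -/
theorem ne_of_mem {a b : Fin nm} (h : (a, b) ∈ L) : a ≠ b := fun e => hP.irrefl a (by rw [← e] at h; exact h)

/-- partners are unique. [cite: KhristoforovSmirnov2021, §1.2 (arXiv v1 p. 2: «matching marked points»)] -/
theorem partner_eq {a b c : Fin nm} (hb : (a, b) ∈ L) (hc : (a, c) ∈ L) : b = c :=
  (hP.perfect a (hP.off a b hb)).unique hb hc

/-- partners are unique (left). [cite: KhristoforovSmirnov2021, §1.2 (arXiv v1 p. 2: «matching marked points»)] -/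
theorem partner_eq_left {a b c : Fin nm} (ha : (a, c) ∈ L) (hb : (b, c) ∈ L) : a = b :=
  hP.partner_eq (hP.symm a c ha) (hP.symm b c hb)

/-- **no crossing, linear form**: two pairs `(x, z)`, `(y, w)` never satisfy `x < y < z < w`.
[cite: KhristoforovSmirnov2021, §1.2 (arXiv v1 p. 2: «disjoint paths»)] -/
theorem not_cross {x y z w : Fin nm} (hxz : (x, z) ∈ L) (hyw : (y, w) ∈ L) : ¬ (x < y ∧ y < z ∧ z < w) :=
  fun h => hP.planar x y z w hxz hyw (Or.inl h)

end IsPattern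

/-- **the enclosing pairs** of `j` under `L`: the pairs `(c, d) ∈ L` with `c < j < d` (`depth j L` is their number).
[cite: KhristoforovSmirnov2021, §1.2 (arXiv v1 p. 2: the link pattern)] -/
def encl (j : Fin nm) (L : Finset (Fin nm × Fin nm)) : Finset (Fin nm × Fin nm) := L.filter fun cd => cd.1 < j ∧ j < cd.2

/-- membership in `encl`. [cite: KhristoforovSmirnov2021, §1.2 (arXiv v1 p. 2)] -/
theorem mem_encl {j : Fin nm} {L : Finset (Fin nm × Fin nm)} {cd : Fin nm × Fin nm} :
    cd ∈ encl j L ↔ cd ∈ L ∧ cd.1 < j ∧ j < cd.2 := Finset.mem_filter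

/-- the depth counts the enclosing pairs. [cite: KhristoforovSmirnov2021, §1.2 (arXiv v1 p. 2)] -/
theorem depth_eq_card_encl (j : Fin nm) (L : Finset (Fin nm × Fin nm)) : depth j L = #(encl j L) := rfl

/-- positive depth means an enclosing pair exists. [cite: KhristoforovSmirnov2021, §1.2 (arXiv v1 p. 2)] -/
theorem encl_nonempty_iff {j : Fin nm} {L : Finset (Fin nm × Fin nm)} : (encl j L).Nonempty ↔ 0 < depth j L := by
  rw [depth_eq_card_encl, Finset.card_pos]

/-- **the innermost enclosing chord** `(α, γ)` of `j` under `L`: an enclosing pair with the largest first entry (for a pattern of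
positive depth; `(j, j)` otherwise — never used). [cite: KhristoforovSmirnov2021, §1.2 (arXiv v1 p. 2: the link pattern)] -/
noncomputable def innerPair (j : Fin nm) (L : Finset (Fin nm × Fin nm)) : Fin nm × Fin nm :=
  if h : (encl j L).Nonempty then Classical.choose (Finset.exists_max_image (encl j L) Prod.fst h) else (j, j)

/-- the defining property of the innermost chord. [cite: KhristoforovSmirnov2021, §1.2 (arXiv v1 p. 2)] -/
theorem innerPair_spec {j : Fin nm} {L : Finset (Fin nm × Fin nm)} (h : 0 < depth j L) :
    innerPair j L ∈ encl j L ∧ ∀ cd ∈ encl j L, cd.1 ≤ (innerPair j L).1 := by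
  have hne : (encl j L).Nonempty := encl_nonempty_iff.2 h
  unfold innerPair
  rw [dif_pos hne]
  exact Classical.choose_spec (Finset.exists_max_image (encl j L) Prod.fst hne)

/-- the innermost chord is a pair of `L` enclosing `j`. [cite: KhristoforovSmirnov2021, §1.2 (arXiv v1 p. 2)] -/
theorem innerPair_mem {j : Fin nm} {L : Finset (Fin nm × Fin nm)} (h : 0 < depth j L) :
    ((innerPair j L).1, (innerPair j L).2) ∈ L ∧ (innerPair j L).1 < j ∧ j < (innerPair j L).2 :=
  mem_encl.1 (innerPair_spec h).1

/-- removing both orientations of a chord. [folklore] -/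
def strip (L : Finset (Fin nm × Fin nm)) (a b : Fin nm) : Finset (Fin nm × Fin nm) := (L.erase (a, b)).erase (b, a)

/-- membership in `strip`. [folklore] -/
private theorem mem_strip {L : Finset (Fin nm × Fin nm)} {a b x y : Fin nm} :
    (x, y) ∈ strip L a b ↔ (x, y) ∈ L ∧ ¬ (x = a ∧ y = b) ∧ ¬ (x = b ∧ y = a) := by
  unfold strip
  rw [Finset.mem_erase, Finset.mem_erase, Ne, Ne, Prod.mk.injEq, Prod.mk.injEq]
  tauto

/-- putting the chord back. [folklore] -/
private theorem withPair_strip {L : Finset (Fin nm × Fin nm)} {a b : Fin nm} (hab : (a, b) ∈ L) (hba : (b, a) ∈ L) :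
    withPair (strip L a b) b a = L := by
  ext ⟨x, y⟩
  rw [mem_withPair, mem_strip]
  constructor
  · rintro (⟨rfl, rfl⟩ | ⟨rfl, rfl⟩ | ⟨h, -, -⟩)
    · exact hba
    · exact hab
    · exact h
  · intro h
    by_cases h1 : x = b ∧ y = a
    · exact Or.inl h1
    by_cases h2 : x = a ∧ y = b
    · exact Or.inr (Or.inl h2)
    · exact Or.inr (Or.inr ⟨h, h2, h1⟩)

/-- stripping a chord that was just added to a relation avoiding it. [folklore] -/
private theorem strip_withPair {L₀ : Finset (Fin nm × Fin nm)} {a b : Fin nm} (hab : (a, b) ∉ L₀) (hba : (b, a) ∉ L₀) :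
    strip (withPair L₀ b a) a b = L₀ := by
  ext ⟨x, y⟩
  rw [mem_strip, mem_withPair]
  constructor
  · rintro ⟨h | h | h, h2, h1⟩
    · exact absurd h h1
    · exact absurd h h2
    · exact h
  · intro h
    exact ⟨Or.inr (Or.inr h), fun e => hab (by rw [← e.1, ← e.2]; exact h), fun e => hba (by rw [← e.1, ← e.2]; exact h)⟩

/-- **the lo descent** of a pattern of positive depth: the partner moves to the lower end `α` of the innermost enclosing chord
`(α, γ)`, which is rewired to `{j, γ}`. [cite: KhristoforovSmirnov2021, §2 Lemma 4, proof and Fig. 3 (p. 4)] -/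
noncomputable def loDesc (j : Fin nm) (L : Finset (Fin nm × Fin nm)) : Fin nm × Finset (Fin nm × Fin nm) :=
  ((innerPair j L).1, withPair (strip L (innerPair j L).1 (innerPair j L).2) j (innerPair j L).2)

/-- **the hi descent** of a pattern of positive depth: the partner moves to the upper end `γ` of the innermost enclosing chord
`(α, γ)`, which is rewired to `{α, j}`. [cite: KhristoforovSmirnov2021, §2 Lemma 4, proof and Fig. 3 (p. 4)] -/
noncomputable def hiDesc (j : Fin nm) (L : Finset (Fin nm × Fin nm)) : Fin nm × Finset (Fin nm × Fin nm) :=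
  ((innerPair j L).2, withPair (strip L (innerPair j L).1 (innerPair j L).2) (innerPair j L).1 j)

/-- **the innermost chord is innermost**: every other enclosing pair of a PATTERN lies strictly outside it.
[cite: KhristoforovSmirnov2021, §1.2 (arXiv v1 p. 2: «disjoint paths»)] -/
theorem innerPair_innermost {j : Fin nm} {L : Finset (Fin nm × Fin nm)} (hP : IsPattern j L) (h : 0 < depth j L)
    {c d : Fin nm} (hcd : (c, d) ∈ L) (hc : c < j) (hd : j < d) :
    (c = (innerPair j L).1 ∧ d = (innerPair j L).2) ∨ (c < (innerPair j L).1 ∧ (innerPair j L).2 < d) := by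
  obtain ⟨hmem, hα, hγ⟩ := innerPair_mem h
  have hle : c ≤ (innerPair j L).1 := (innerPair_spec h).2 (c, d) (mem_encl.2 ⟨hcd, hc, hd⟩)
  rcases hle.lt_or_eq with hlt | heq
  · right
    refine ⟨hlt, ?_⟩
    rcases lt_trichotomy d (innerPair j L).2 with hlt' | heq' | hgt'
    · exact absurd ⟨hlt, hα.trans hd, hlt'⟩ (hP.not_cross hcd hmem)
    · exact absurd (hP.partner_eq_left hcd (heq' ▸ hmem)) hlt.ne
    · exact hgt'
  · left
    exact ⟨heq, hP.partner_eq (heq ▸ hcd) hmem⟩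

/-- a cyclically increasing triple has distinct entries. [folklore] -/
private theorem ccwTriple_ne {a b c : Fin nm} (h : CcwTriple a b c) : a ≠ b ∧ b ≠ c ∧ a ≠ c := by
  unfold CcwTriple at h
  simp only [Fin.lt_def] at h
  refine ⟨?_, ?_, ?_⟩ <;> intro e <;> have := congrArg Fin.val e <;> omega

/-- **the patterns of a tripod picture are patterns** (stated for the first pattern `(α; L₀ + βγ)`; the other two by rotation).
[cite: KhristoforovSmirnov2021, §2 Lemma 4, proof and Fig. 3 (p. 4); §1.2 (p. 2)] -/
theorem TripodPicture.isPattern_lo {α β γ : Fin nm} {L₀ : Finset (Fin nm × Fin nm)} (h : TripodPicture α β γ L₀) :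
    IsPattern α (withPair L₀ β γ) := by
  obtain ⟨nαβ, nβγ, nαγ⟩ := ccwTriple_ne h.ccw
  have big : ∀ {x z : Fin nm}, (x, z) ∈ withPair L₀ β γ → (x, z) ∈ withPair (withPair (withPair L₀ α β) β γ) γ α := by
    intro x z hxz
    rw [mem_chords']
    rw [mem_withPair] at hxz
    tauto
  have chβγ : (β, γ) ∈ withPair (withPair (withPair L₀ α β) β γ) γ α := by rw [mem_chords']; tauto
  have chγβ : (γ, β) ∈ withPair (withPair (withPair L₀ α β) β γ) γ α := by rw [mem_chords']; tauto
  refine ⟨fun a b hab => ?_, fun a haa => ?_, fun a b hab => ?_, fun a ha => ?_, fun x y z w hxz hyw => ?_⟩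
  · rw [mem_withPair] at hab ⊢
    rcases hab with ⟨rfl, rfl⟩ | ⟨rfl, rfl⟩ | hab
    · exact Or.inr (Or.inl ⟨rfl, rfl⟩)
    · exact Or.inl ⟨rfl, rfl⟩
    · exact Or.inr (Or.inr (h.symm a b hab))
  · rw [mem_withPair] at haa
    rcases haa with ⟨rfl, e⟩ | ⟨rfl, e⟩ | haa
    · exact nβγ e
    · exact nβγ e.symm
    · exact h.irrefl a haa
  · rw [mem_withPair] at hab
    rcases hab with ⟨rfl, -⟩ | ⟨rfl, -⟩ | hab
    · exact fun e => nαβ e.symm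
    · exact fun e => nαγ e.symm
    · exact (h.off a b hab).1
  · by_cases haβ : a = β
    · subst haβ
      refine ⟨γ, ?_, fun b hb => ?_⟩
      · show (a, γ) ∈ withPair L₀ a γ
        rw [mem_withPair]; exact Or.inl ⟨rfl, rfl⟩
      · have hb : (a, b) ∈ withPair L₀ a γ := hb
        rw [mem_withPair] at hb
        rcases hb with ⟨-, rfl⟩ | ⟨e, -⟩ | hb
        · rfl
        · exact absurd e nβγ
        · exact absurd rfl (h.off a b hb).2.1
    by_cases haγ : a = γ
    · subst haγ
      refine ⟨β, ?_, fun b hb => ?_⟩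
      · show (a, β) ∈ withPair L₀ β a
        rw [mem_withPair]; exact Or.inr (Or.inl ⟨rfl, rfl⟩)
      · have hb : (a, b) ∈ withPair L₀ β a := hb
        rw [mem_withPair] at hb
        rcases hb with ⟨e, -⟩ | ⟨-, rfl⟩ | hb
        · exact absurd e.symm nβγ
        · rfl
        · exact absurd rfl (h.off a b hb).2.2
    obtain ⟨b, hb, huniq⟩ := h.perfect a ha haβ haγ
    refine ⟨b, ?_, fun b' hb' => ?_⟩
    · show (a, b) ∈ withPair L₀ β γ
      rw [mem_withPair]; exact Or.inr (Or.inr hb)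
    · have hb' : (a, b') ∈ withPair L₀ β γ := hb'
      rw [mem_withPair] at hb'
      rcases hb' with ⟨e, -⟩ | ⟨e, -⟩ | hb'
      · exact absurd e haβ
      · exact absurd e haγ
      · exact huniq b' hb'
  · rw [mem_withPair] at hyw
    rcases hyw with ⟨rfl, rfl⟩ | ⟨rfl, rfl⟩ | hyw
    · -- (y, w) = (β, γ)
      rw [mem_withPair] at hxz
      rcases hxz with ⟨rfl, rfl⟩ | ⟨rfl, rfl⟩ | hxz
      · exact fun hq => (ccwQuad_ne hq).1 rfl
      · exact fun hq => (ccwQuad_ne hq).2.1 rfl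
      · rw [ccwQuad_rot]
        exact h.planar y z w x chβγ (h.symm x z hxz)
    · -- (y, w) = (γ, β)
      rw [mem_withPair] at hxz
      rcases hxz with ⟨rfl, rfl⟩ | ⟨rfl, rfl⟩ | hxz
      · exact fun hq => (ccwQuad_ne hq).2.1 rfl
      · exact fun hq => (ccwQuad_ne hq).1 rfl
      · rw [ccwQuad_rot]
        exact h.planar y z w x chγβ (h.symm x z hxz)
    · exact h.planar x y z w (big hxz) hyw

/-- **positions of the other chords of a pattern relative to the innermost chord `(α, γ)` around `j`**: a chord avoids `α, j, γ`,
has both ends on the same side of `(α, γ)`, and — if inside — both ends on the same side of `j`.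
[cite: KhristoforovSmirnov2021, §1.2 (arXiv v1 p. 2: «disjoint paths»)] -/
theorem pair_position {j : Fin nm} {L : Finset (Fin nm × Fin nm)} (hP : IsPattern j L) (h : 0 < depth j L) {y w : Fin nm}
    (hyw : (y, w) ∈ L) (hne : ¬ (y = (innerPair j L).1 ∧ w = (innerPair j L).2))
    (hne' : ¬ (y = (innerPair j L).2 ∧ w = (innerPair j L).1)) :
    y ≠ (innerPair j L).1 ∧ y ≠ (innerPair j L).2 ∧ w ≠ (innerPair j L).1 ∧ w ≠ (innerPair j L).2 ∧ y ≠ j ∧ w ≠ j ∧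
      (((innerPair j L).1 < y ∧ y < (innerPair j L).2) ↔ ((innerPair j L).1 < w ∧ w < (innerPair j L).2)) ∧
      ((innerPair j L).1 < y → y < (innerPair j L).2 → (y < j ↔ w < j)) := by
  obtain ⟨hmem, hα, hγ⟩ := innerPair_mem h
  have hmem' := hP.symm _ _ hmem
  have hwy := hP.symm _ _ hyw
  have hyα : y ≠ (innerPair j L).1 := fun e => hne ⟨e, hP.partner_eq (e ▸ hyw) hmem⟩
  have hyγ : y ≠ (innerPair j L).2 := fun e => hne' ⟨e, hP.partner_eq (e ▸ hyw) hmem'⟩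
  have hwα : w ≠ (innerPair j L).1 := fun e => hyγ (hP.partner_eq_left hyw (e ▸ hmem'))
  have hwγ : w ≠ (innerPair j L).2 := fun e => hyα (hP.partner_eq_left hyw (e ▸ hmem))
  have hyj : y ≠ j := hP.off y w hyw
  have hwj : w ≠ j := hP.off₂ hyw
  -- same side of the chord
  have side : ∀ {y w : Fin nm}, (y, w) ∈ L → w ≠ (innerPair j L).1 → w ≠ (innerPair j L).2 →
      (innerPair j L).1 < y → y < (innerPair j L).2 → (innerPair j L).1 < w ∧ w < (innerPair j L).2 := by
    intro y w hyw hwα hwγ h1 h2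
    rcases lt_or_gt_of_ne hwγ with h3 | h3
    · rcases lt_or_gt_of_ne hwα with h4 | h4
      · exact absurd ⟨h4, h1, h2⟩ (hP.not_cross (hP.symm _ _ hyw) hmem)
      · exact ⟨h4, h3⟩
    · exact absurd ⟨h1, h2, h3⟩ (hP.not_cross hmem hyw)
  refine ⟨hyα, hyγ, hwα, hwγ, hyj, hwj, ⟨fun hy => side hyw hwα hwγ hy.1 hy.2, fun hw => side hwy hyα hyγ hw.1 hw.2⟩,
    fun h1 h2 => ?_⟩
  obtain ⟨h3, h4⟩ := side hyw hwα hwγ h1 h2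
  constructor
  · intro hy
    rcases lt_or_gt_of_ne hwj with hw | hw
    · exact hw
    · rcases innerPair_innermost hP h hyw hy hw with e | e
      · exact absurd e hne
      · exact absurd h1 (lt_asymm e.1)
  · intro hw
    rcases lt_or_gt_of_ne hyj with hy | hy
    · exact hy
    · rcases innerPair_innermost hP h hwy hw hy with e | e
      · exact absurd e.1 hwα
      · exact absurd h3 (lt_asymm e.1)

/-- ★ **a pattern of positive depth is the mid pattern of an increasing tripod picture**: `(α, j, γ; L ∖ {αγ})` with `(α, γ)` the
innermost chord around `j`. [cite: KhristoforovSmirnov2021, §2 Lemma 4, proof and Fig. 3 (p. 4); §1.2 (p. 2)] -/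
theorem tripodPicture_of_pattern {j : Fin nm} {L : Finset (Fin nm × Fin nm)} (hP : IsPattern j L) (h : 0 < depth j L) :
    TripodPicture (innerPair j L).1 j (innerPair j L).2 (strip L (innerPair j L).1 (innerPair j L).2) := by
  obtain ⟨hmem, hα, hγ⟩ := innerPair_mem h
  have hmem' := hP.symm _ _ hmem
  refine ⟨Or.inl ⟨hα, hγ⟩, fun a b hab => ?_, fun a haa => ?_, fun a b hab => ?_, fun a ha hb hc => ?_, fun x y z w hxz hyw => ?_⟩
  · rw [mem_strip] at hab ⊢
    exact ⟨hP.symm a b hab.1, fun e => hab.2.2 ⟨e.2, e.1⟩, fun e => hab.2.1 ⟨e.2, e.1⟩⟩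
  · rw [mem_strip] at haa
    exact hP.irrefl a haa.1
  · rw [mem_strip] at hab
    obtain ⟨hab, h1, h2⟩ := hab
    refine ⟨fun e => h1 ⟨e, hP.partner_eq (e ▸ hab) hmem⟩, hP.off a b hab, fun e => h2 ⟨e, hP.partner_eq (e ▸ hab) hmem'⟩⟩
  · obtain ⟨b, hb, huniq⟩ := hP.perfect a hb
    refine ⟨b, mem_strip.2 ⟨hb, fun e => ha e.1, fun e => hc e.1⟩, fun b' hb' => huniq b' (mem_strip.1 hb').1⟩
  · rw [mem_strip] at hyw
    obtain ⟨hyw, hne, hne'⟩ := hyw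
    obtain ⟨hyα, hyγ, hwα, hwγ, hyj, hwj, hside, hin⟩ := pair_position hP h hyw hne hne'
    rw [mem_chords'] at hxz
    rcases hxz with ⟨rfl, rfl⟩ | ⟨rfl, rfl⟩ | ⟨rfl, rfl⟩ | ⟨rfl, rfl⟩ | ⟨rfl, rfl⟩ | ⟨rfl, rfl⟩ | hxz
    · exact hP.planar _ _ _ _ hmem' hyw
    · exact hP.planar _ _ _ _ hmem hyw
    all_goals try exact hP.planar _ _ _ _ (mem_strip.1 hxz).1 hyw
    all_goals
      unfold CcwQuad
      simp only [Fin.lt_def] at *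
      have vyα := Fin.val_ne_of_ne hyα; have vyγ := Fin.val_ne_of_ne hyγ; have vwα := Fin.val_ne_of_ne hwα
      have vwγ := Fin.val_ne_of_ne hwγ; have vyj := Fin.val_ne_of_ne hyj; have vwj := Fin.val_ne_of_ne hwj
      omega

/-- **the innermost chord of the mid pattern of an increasing picture is `(α, γ)`.**
[cite: KhristoforovSmirnov2021, §2 Lemma 4, proof and Fig. 3 (p. 4)] -/
theorem innerPair_midPat {α β γ : Fin nm} {L₀ : Finset (Fin nm × Fin nm)} (hP : TripodPicture α β γ L₀) (hαβ : α < β) (hβγ : β < γ) :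
    innerPair β (withPair L₀ γ α) = (α, γ) := by
  have hd : 0 < depth β (withPair L₀ γ α) := by rw [(depth_patterns hP hαβ hβγ).1]; exact Nat.succ_pos _
  obtain ⟨hq, hmax⟩ := innerPair_spec hd
  have hαγ : (α, γ) ∈ encl β (withPair L₀ γ α) := mem_encl.2 ⟨by rw [mem_withPair]; exact Or.inr (Or.inl ⟨rfl, rfl⟩), hαβ, hβγ⟩
  have hle : α ≤ (innerPair β (withPair L₀ γ α)).1 := hmax _ hαγ
  obtain ⟨hq1, hq2, hq3⟩ := mem_encl.1 hq
  have chαβ : (α, β) ∈ withPair (withPair (withPair L₀ α β) β γ) γ α := by rw [mem_chords']; tauto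
  rw [mem_withPair] at hq1
  rcases hq1 with ⟨e1, -⟩ | ⟨e1, e2⟩ | hq1
  · rw [e1] at hq2; exact absurd hq2 (lt_asymm hβγ)
  · exact Prod.ext e1 e2
  · exfalso
    have hoff := (hP.off _ _ hq1).1
    have hp := hP.planar α _ β _ chαβ hq1
    unfold CcwQuad at hp
    rcases hle.lt_or_eq with hlt | heq
    · exact hp (Or.inl ⟨hlt, hq2, hq3⟩)
    · exact hoff heq.symm

/-- the relation of a picture avoids the chord `{α, γ}`. [cite: KhristoforovSmirnov2021, §2 Lemma 4, proof and Fig. 3 (p. 4)] -/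
private theorem chord_not_mem {α β γ : Fin nm} {L₀ : Finset (Fin nm × Fin nm)} (hP : TripodPicture α β γ L₀) :
    (α, γ) ∉ L₀ ∧ (γ, α) ∉ L₀ :=
  ⟨fun hm => (hP.off α γ hm).1 rfl, fun hm => (hP.off γ α hm).2.2 rfl⟩

/-- **the lo descent of the mid pattern is the lo pattern.** [cite: KhristoforovSmirnov2021, §2 Lemma 4, proof and Fig. 3 (p. 4)] -/
theorem loDesc_midPat {α β γ : Fin nm} {L₀ : Finset (Fin nm × Fin nm)} (hP : TripodPicture α β γ L₀) (hαβ : α < β) (hβγ : β < γ) :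
    loDesc β (withPair L₀ γ α) = (α, withPair L₀ β γ) := by
  unfold loDesc
  rw [innerPair_midPat hP hαβ hβγ, strip_withPair (chord_not_mem hP).1 (chord_not_mem hP).2]

/-- **the hi descent of the mid pattern is the hi pattern.** [cite: KhristoforovSmirnov2021, §2 Lemma 4, proof and Fig. 3 (p. 4)] -/
theorem hiDesc_midPat {α β γ : Fin nm} {L₀ : Finset (Fin nm × Fin nm)} (hP : TripodPicture α β γ L₀) (hαβ : α < β) (hβγ : β < γ) :
    hiDesc β (withPair L₀ γ α) = (γ, withPair L₀ α β) := by
  unfold hiDesc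
  rw [innerPair_midPat hP hαβ hβγ, strip_withPair (chord_not_mem hP).1 (chord_not_mem hP).2]

/-- stripping the innermost chord and putting it back. [folklore] -/
private theorem withPair_strip_inner {j : Fin nm} {L : Finset (Fin nm × Fin nm)} (hP : IsPattern j L) (h : 0 < depth j L) :
    withPair (strip L (innerPair j L).1 (innerPair j L).2) (innerPair j L).2 (innerPair j L).1 = L :=
  withPair_strip (innerPair_mem h).1 (hP.symm _ _ (innerPair_mem h).1)

/-- **the depth of a pattern exceeds the depth of its descents by one.** [cite: KhristoforovSmirnov2021, §2 Lemma 4, proof and Fig. 3 (p. 4)] -/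
theorem depth_loDesc {j : Fin nm} {L : Finset (Fin nm × Fin nm)} (hP : IsPattern j L) (h : 0 < depth j L) :
    depth (loDesc j L).1 (loDesc j L).2 + 1 = depth j L := by
  have key := depth_patterns (tripodPicture_of_pattern hP h) (innerPair_mem h).2.1 (innerPair_mem h).2.2
  rw [withPair_strip_inner hP h] at key
  unfold loDesc
  rw [key.2.1, key.1]

/-- Auxiliary. [cite: KhristoforovSmirnov2021, §2 Lemma 4, proof and Fig. 3 (p. 4)] -/
theorem depth_hiDesc {j : Fin nm} {L : Finset (Fin nm × Fin nm)} (hP : IsPattern j L) (h : 0 < depth j L) :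
    depth (hiDesc j L).1 (hiDesc j L).2 + 1 = depth j L := by
  have key := depth_patterns (tripodPicture_of_pattern hP h) (innerPair_mem h).2.1 (innerPair_mem h).2.2
  rw [withPair_strip_inner hP h] at key
  unfold hiDesc
  rw [key.2.2, key.1]

/-- **descents of patterns are patterns.** [cite: KhristoforovSmirnov2021, §2 Lemma 4, proof and Fig. 3 (p. 4); §1.2 (p. 2)] -/
theorem isPattern_loDesc {j : Fin nm} {L : Finset (Fin nm × Fin nm)} (hP : IsPattern j L) (h : 0 < depth j L) :
    IsPattern (loDesc j L).1 (loDesc j L).2 :=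
  (tripodPicture_of_pattern hP h).isPattern_lo

/-- Auxiliary. [cite: KhristoforovSmirnov2021, §2 Lemma 4, proof and Fig. 3 (p. 4); §1.2 (p. 2)] -/
theorem isPattern_hiDesc {j : Fin nm} {L : Finset (Fin nm × Fin nm)} (hP : IsPattern j L) (h : 0 < depth j L) :
    IsPattern (hiDesc j L).1 (hiDesc j L).2 :=
  (tripodPicture_of_pattern hP h).rotate.rotate.isPattern_lo

end Patterns

/-! ### The tripod law as a depth recursion -/

section Recursion

variable {nm : ℕ}

/-- the relation of an INCREASING picture from the depth recursion. [cite: KhristoforovSmirnov2021, §2 Lemma 4, proof and Fig. 3 (p. 4)] -/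
private theorem rel_of_rec_incr {wt : Fin nm → Finset (Fin nm × Fin nm) → ℂ}
    (hrec : ∀ (j : Fin nm) (L : Finset (Fin nm × Fin nm)), IsPattern j L → 0 < depth j L →
      wt j L = -tau ^ 2 * wt (loDesc j L).1 (loDesc j L).2 - tau * wt (hiDesc j L).1 (hiDesc j L).2)
    {α β γ : Fin nm} {L₀ : Finset (Fin nm × Fin nm)} (hP : TripodPicture α β γ L₀) (hαβ : α < β) (hβγ : β < γ) :
    wt α (withPair L₀ β γ) + tau * wt β (withPair L₀ γ α) + tau ^ 2 * wt γ (withPair L₀ α β) = 0 := by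
  have hpat : IsPattern β (withPair L₀ γ α) := hP.rotate.isPattern_lo
  have hd : 0 < depth β (withPair L₀ γ α) := by rw [(depth_patterns hP hαβ hβγ).1]; exact Nat.succ_pos _
  have h := hrec β _ hpat hd
  rw [loDesc_midPat hP hαβ hβγ, hiDesc_midPat hP hαβ hβγ] at h
  dsimp only at h
  rw [h]
  linear_combination (-(wt α (withPair L₀ β γ))) * tau_pow_three'

/-- ★★ **THE TRIPOD LAW IS A RECURSION IN THE DEPTH**: a class weight obeys the tripod law iff at every pattern of positive depth
its value is `−τ²·(value at the lo descent) − τ·(value at the hi descent)`; the values at the outermost patterns (depth `0`) are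
unconstrained. [cite: KhristoforovSmirnov2021, §2 Lemma 4, proof and Fig. 3 (p. 4: «each triple contributes zero»)] -/
theorem tripodLaw_iff_rec {wt : Fin nm → Finset (Fin nm × Fin nm) → ℂ} :
    TripodLaw wt ↔ ∀ (j : Fin nm) (L : Finset (Fin nm × Fin nm)), IsPattern j L → 0 < depth j L →
      wt j L = -tau ^ 2 * wt (loDesc j L).1 (loDesc j L).2 - tau * wt (hiDesc j L).1 (hiDesc j L).2 := by
  constructor
  · intro hT j L hP hd
    have h := hT _ _ _ _ (tripodPicture_of_pattern hP hd)
    rw [withPair_strip_inner hP hd] at h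
    unfold loDesc hiDesc
    dsimp only
    linear_combination tau ^ 2 * h - (wt j L + tau * wt (innerPair j L).2
      (withPair (strip L (innerPair j L).1 (innerPair j L).2) (innerPair j L).1 j)) * tau_pow_three'
  · intro hrec α β γ L₀ hP
    rcases hP.ccw with ⟨h1, h2⟩ | ⟨h1, h2⟩ | ⟨h1, h2⟩
    · exact rel_of_rec_incr hrec hP h1 h2
    · have h := rel_of_rec_incr hrec hP.rotate h1 h2
      linear_combination tau * h - wt α (withPair L₀ β γ) * tau_pow_three'
    · have h := rel_of_rec_incr hrec hP.rotate.rotate h1 h2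
      linear_combination tau ^ 2 * h - (wt α (withPair L₀ β γ) + tau * wt β (withPair L₀ γ α)) * tau_pow_three'

end Recursion

/-! ### The solution space: free data on the outermost patterns -/

section Solutions

variable {nm : ℕ}

/-- **the type of patterns** on `k` corners. [cite: KhristoforovSmirnov2021, §1.2 (arXiv v1 p. 2: the link pattern)] -/
abbrev Pat (nm : ℕ) : Type := {p : Fin nm × Finset (Fin nm × Fin nm) // IsPattern p.1 p.2}

/-- patterns form a finite type. [cite: KhristoforovSmirnov2021, §1.2 (arXiv v1 p. 2)] -/
noncomputable instance instFintypePat : Fintype (Pat nm) := Fintype.ofFinite _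

namespace Pat

variable (p : Pat nm)

/-- the depth of a pattern. [cite: KhristoforovSmirnov2021, §1.2 (arXiv v1 p. 2)] -/
def pdepth : ℕ := depth p.1.1 p.1.2

/-- the lo descent as a pattern (itself at depth `0`, never used there). [cite: KhristoforovSmirnov2021, §2 Lemma 4, proof and Fig. 3 (p. 4)] -/
noncomputable def lo : Pat nm := if h : 0 < p.pdepth then ⟨loDesc p.1.1 p.1.2, isPattern_loDesc p.2 h⟩ else p

/-- the hi descent as a pattern (itself at depth `0`, never used there). [cite: KhristoforovSmirnov2021, §2 Lemma 4, proof and Fig. 3 (p. 4)] -/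
noncomputable def hi : Pat nm := if h : 0 < p.pdepth then ⟨hiDesc p.1.1 p.1.2, isPattern_hiDesc p.2 h⟩ else p

/-- Auxiliary. [cite: KhristoforovSmirnov2021, §2 Lemma 4, proof and Fig. 3 (p. 4)] -/
theorem lo_val (h : 0 < p.pdepth) : p.lo.1 = loDesc p.1.1 p.1.2 := by unfold lo; rw [dif_pos h]

/-- Auxiliary. [cite: KhristoforovSmirnov2021, §2 Lemma 4, proof and Fig. 3 (p. 4)] -/
theorem hi_val (h : 0 < p.pdepth) : p.hi.1 = hiDesc p.1.1 p.1.2 := by unfold hi; rw [dif_pos h]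

/-- the lo descent is one less deep. [cite: KhristoforovSmirnov2021, §2 Lemma 4, proof and Fig. 3 (p. 4)] -/
theorem pdepth_lo (h : 0 < p.pdepth) : p.lo.pdepth + 1 = p.pdepth := by
  show depth p.lo.1.1 p.lo.1.2 + 1 = depth p.1.1 p.1.2
  rw [p.lo_val h]
  exact depth_loDesc p.2 h

/-- the hi descent is one less deep. [cite: KhristoforovSmirnov2021, §2 Lemma 4, proof and Fig. 3 (p. 4)] -/
theorem pdepth_hi (h : 0 < p.pdepth) : p.hi.pdepth + 1 = p.pdepth := by
  show depth p.hi.1.1 p.hi.1.2 + 1 = depth p.1.1 p.1.2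
  rw [p.hi_val h]
  exact depth_hiDesc p.2 h

/-- Auxiliary. [cite: KhristoforovSmirnov2021, §2 Lemma 4, proof and Fig. 3 (p. 4)] -/
theorem pdepth_lo_lt (h : 0 < p.pdepth) : p.lo.pdepth < p.pdepth := by have := p.pdepth_lo h; omega

/-- Auxiliary. [cite: KhristoforovSmirnov2021, §2 Lemma 4, proof and Fig. 3 (p. 4)] -/
theorem pdepth_hi_lt (h : 0 < p.pdepth) : p.hi.pdepth < p.pdepth := by have := p.pdepth_hi h; omega

end Pat

/-- **the OUTERMOST patterns**: depth `0` — no chord encloses the partner.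
[cite: KhristoforovSmirnov2021, §1.2 (arXiv v1 p. 2: the link pattern)] -/
abbrev Pat₀ (nm : ℕ) : Type := {p : Pat nm // p.pdepth = 0}

/-- outermost patterns form a finite type. [cite: KhristoforovSmirnov2021, §1.2 (arXiv v1 p. 2)] -/
noncomputable instance instFintypePat₀ : Fintype (Pat₀ nm) := Fintype.ofFinite _

variable (nm) in
/-- ★ **the SOLUTION SPACE of the tripod law** on pattern weights: the functions `w : Pat k → ℂ` with
`w p = −τ²·w p.lo − τ·w p.hi` at every pattern of positive depth (a `ℂ`-subspace).
[cite: KhristoforovSmirnov2021, §2 Lemma 4, proof and Fig. 3 (p. 4: «each triple contributes zero»)] -/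
def solW : Submodule ℂ (Pat nm → ℂ) where
  carrier := {w | ∀ p : Pat nm, 0 < p.pdepth → w p = -tau ^ 2 * w p.lo - tau * w p.hi}
  add_mem' := by
    intro a b ha hb p hp
    simp only [Pi.add_apply]
    rw [ha p hp, hb p hp]
    ring
  zero_mem' := by
    intro p _
    simp only [Pi.zero_apply, mul_zero, sub_zero]
  smul_mem' := by
    intro c w hw p hp
    simp only [Pi.smul_apply, smul_eq_mul]
    rw [hw p hp]
    ring

/-- membership in the solution space. [cite: KhristoforovSmirnov2021, §2 Lemma 4, proof and Fig. 3 (p. 4)] -/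
theorem mem_solW {w : Pat nm → ℂ} : w ∈ solW nm ↔ ∀ p : Pat nm, 0 < p.pdepth → w p = -tau ^ 2 * w p.lo - tau * w p.hi := Iff.rfl

/-- ★ **the solution with prescribed outermost values** `φ`, by recursion on the depth.
[cite: KhristoforovSmirnov2021, §2 Lemma 4, proof and Fig. 3 (p. 4)] -/
noncomputable def extend (φ : Pat₀ nm → ℂ) (p : Pat nm) : ℂ :=
  if h : 0 < p.pdepth then -tau ^ 2 * extend φ p.lo - tau * extend φ p.hi else φ ⟨p, Nat.eq_zero_of_not_pos h⟩
termination_by p.pdepth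
decreasing_by
  · exact p.pdepth_lo_lt h
  · exact p.pdepth_hi_lt h

/-- the recursion step of `extend`. [cite: KhristoforovSmirnov2021, §2 Lemma 4, proof and Fig. 3 (p. 4)] -/
theorem extend_of_pos (φ : Pat₀ nm → ℂ) (p : Pat nm) (h : 0 < p.pdepth) :
    extend φ p = -tau ^ 2 * extend φ p.lo - tau * extend φ p.hi := by
  rw [extend, dif_pos h]

/-- the initial values of `extend`. [cite: KhristoforovSmirnov2021, §2 Lemma 4, proof and Fig. 3 (p. 4)] -/
theorem extend_of_zero (φ : Pat₀ nm → ℂ) (p : Pat nm) (h : p.pdepth = 0) : extend φ p = φ ⟨p, h⟩ := by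
  rw [extend, dif_neg (by rw [h]; exact lt_irrefl 0)]

/-- `extend φ` solves the recursion. [cite: KhristoforovSmirnov2021, §2 Lemma 4, proof and Fig. 3 (p. 4)] -/
theorem extend_mem_solW (φ : Pat₀ nm → ℂ) : extend φ ∈ solW nm := fun p hp => extend_of_pos φ p hp

/-- ★ **UNIQUENESS**: two solutions with the same outermost values coincide.
[cite: KhristoforovSmirnov2021, §2 Lemma 4, proof and Fig. 3 (p. 4)] -/
theorem eq_of_mem_solW {w w' : Pat nm → ℂ} (hw : w ∈ solW nm) (hw' : w' ∈ solW nm)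
    (h0 : ∀ p : Pat nm, p.pdepth = 0 → w p = w' p) : w = w' := by
  have key : ∀ (n : ℕ) (p : Pat nm), p.pdepth = n → w p = w' p := by
    intro n
    induction n using Nat.strong_induction_on with
    | _ n ih =>
      intro p hp
      rcases Nat.eq_zero_or_pos n with hn | hn
      · exact h0 p (hp.trans hn)
      · have hp' : 0 < p.pdepth := by rw [hp]; exact hn
        rw [hw p hp', hw' p hp', ih _ (hp ▸ p.pdepth_lo_lt hp') p.lo rfl, ih _ (hp ▸ p.pdepth_hi_lt hp') p.hi rfl]
  exact funext fun p => key _ p rfl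

/-- a solution is the extension of its outermost values. [cite: KhristoforovSmirnov2021, §2 Lemma 4, proof and Fig. 3 (p. 4)] -/
theorem eq_extend_of_mem_solW {w : Pat nm → ℂ} (hw : w ∈ solW nm) : w = extend fun q : Pat₀ nm => w q.1 :=
  eq_of_mem_solW hw (extend_mem_solW _) fun p hp => by rw [extend_of_zero _ p hp]

variable (nm) in
/-- ★★★ **THE SOLUTION SPACE IS PARAMETRISED BY THE OUTERMOST VALUES**: restriction to the depth-`0` patterns is a linear
isomorphism `solW k ≃ (Pat₀ k → ℂ)`, with inverse `extend`. [cite: KhristoforovSmirnov2021, §2 Lemma 4, proof and Fig. 3 (p. 4)] -/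
noncomputable def solWEquiv : solW nm ≃ₗ[ℂ] (Pat₀ nm → ℂ) where
  toFun w := fun q => w.1 q.1
  map_add' _ _ := rfl
  map_smul' _ _ := rfl
  invFun φ := ⟨extend φ, extend_mem_solW φ⟩
  left_inv w := Subtype.ext (eq_extend_of_mem_solW w.2).symm
  right_inv φ := funext fun q => extend_of_zero φ q.1 q.2

/-- the restriction map evaluated. [cite: KhristoforovSmirnov2021, §2 Lemma 4, proof and Fig. 3 (p. 4)] -/
theorem solWEquiv_apply (w : solW nm) (q : Pat₀ nm) : solWEquiv nm w q = w.1 q.1 := rfl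

variable (nm) in
/-- ★★★ **DIMENSION**: the solution space of the tripod law has dimension the number of OUTERMOST patterns (for `k = 2l+1` corners:
the number of non-crossing perfect matchings of `k+1` points — bookkeeping, see the header).
[cite: KhristoforovSmirnov2021, §2 Lemma 4, proof and Fig. 3 (p. 4); §1.2 (p. 2)] -/
theorem finrank_solW : Module.finrank ℂ (solW nm) = Fintype.card (Pat₀ nm) := by
  rw [(solWEquiv nm).finrank_eq, Module.finrank_fintype_fun_eq_card]

end Solutions

/-! ### Back to class weights and the `k`-disorder observables -/

section ClassWeights

variable {nm : ℕ}

/-- restriction of a class weight to the patterns. [cite: KhristoforovSmirnov2021, §2 Definition 3 and Lemma 4 (p. 4)] -/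
def restrictW (wt : Fin nm → Finset (Fin nm × Fin nm) → ℂ) : Pat nm → ℂ := fun p => wt p.1.1 p.1.2

/-- ★★ **the tripod law sees only the pattern values, and on them it is the depth recursion**: `TripodLaw wt` iff the restriction
of `wt` to patterns lies in the solution space. [cite: KhristoforovSmirnov2021, §2 Lemma 4, proof and Fig. 3 (p. 4)] -/
theorem tripodLaw_iff_restrict_mem_solW {wt : Fin nm → Finset (Fin nm × Fin nm) → ℂ} :
    TripodLaw wt ↔ restrictW wt ∈ solW nm := by
  rw [tripodLaw_iff_rec, mem_solW]
  constructor
  · intro h p hp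
    show wt p.1.1 p.1.2 = -tau ^ 2 * wt p.lo.1.1 p.lo.1.2 - tau * wt p.hi.1.1 p.hi.1.2
    rw [p.lo_val hp, p.hi_val hp]
    exact h _ _ p.2 hp
  · intro h j L hP hd
    have key := h ⟨(j, L), hP⟩ hd
    unfold restrictW at key
    rw [Pat.lo_val ⟨(j, L), hP⟩ hd, Pat.hi_val ⟨(j, L), hP⟩ hd] at key
    exact key

open Classical in
/-- **the class weight of a pattern weight** (zero off the patterns). [cite: KhristoforovSmirnov2021, §2 Definition 3 and Lemma 4 (p. 4)] -/
noncomputable def classWt (w : Pat nm → ℂ) : Fin nm → Finset (Fin nm × Fin nm) → ℂ :=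
  fun j L => if h : IsPattern j L then w ⟨(j, L), h⟩ else 0

/-- restricting the class weight of `w` gives back `w`. [cite: KhristoforovSmirnov2021, §2 Definition 3 and Lemma 4 (p. 4)] -/
theorem restrictW_classWt (w : Pat nm → ℂ) : restrictW (classWt w) = w := by
  funext p
  unfold restrictW classWt
  rw [dif_pos p.2]

/-- ★★ **every solution is a tripod-law class weight.** [cite: KhristoforovSmirnov2021, §2 Lemma 4, proof and Fig. 3 (p. 4)] -/
theorem tripodLaw_classWt {w : Pat nm → ℂ} (hw : w ∈ solW nm) : TripodLaw (classWt w) :=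
  tripodLaw_iff_restrict_mem_solW.2 (by rw [restrictW_classWt]; exact hw)

/-- ★★★ **a `#Pat₀ k`-dimensional family of discretely holomorphic class-weighted `k`-disorder observables**: for every solution
`w ∈ solW k` (equivalently every choice `φ` of outermost values, `w = extend φ`) and every `k`-marked domain `D`,
`Σ_{i : Fin 3} τ^i ObsW D (classWt w) v i = 0` at every face `v` with three `H_G`-sides (tree `holomorphicW_of_tripodLaw`).
[cite: KhristoforovSmirnov2021, §2 Lemma 4 eq. (3) (p. 4)] -/
theorem holomorphicW_classWt (D : TriMarkedDomain nm) {w : Pat nm → ℂ} (hw : w ∈ solW nm) : HolomorphicW D (classWt w) :=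
  holomorphicW_of_tripodLaw D (tripodLaw_classWt hw)

/-- Auxiliary: the member of the family with outermost values `φ`. [cite: KhristoforovSmirnov2021, §2 Lemma 4 eq. (3) (p. 4)] -/
theorem holomorphicW_extend (D : TriMarkedDomain nm) (φ : Pat₀ nm → ℂ) : HolomorphicW D (classWt (extend φ)) :=
  holomorphicW_classWt D (extend_mem_solW φ)

/-- conversely, **every tripod-law class weight restricts to a solution**, i.e. to `extend` of its outermost values.
[cite: KhristoforovSmirnov2021, §2 Lemma 4, proof and Fig. 3 (p. 4)] -/
theorem restrictW_eq_extend_of_tripodLaw {wt : Fin nm → Finset (Fin nm × Fin nm) → ℂ} (h : TripodLaw wt) :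
    restrictW wt = extend fun q : Pat₀ nm => wt q.1.1.1 q.1.1.2 :=
  eq_extend_of_mem_solW (tripodLaw_iff_restrict_mem_solW.1 h)

/-- **the tree's FAN weight is one member of the family** (`tripodLaw_fan`): its restriction to the patterns of `2l+1` corners lies in
the solution space. [cite: KhristoforovSmirnov2021, §2 Lemma 4, proof and Fig. 3 (p. 4)] -/
theorem restrictW_fanWt_mem_solW (l : ℕ) : restrictW (fanWt l) ∈ solW (2 * l + 1) :=
  tripodLaw_iff_restrict_mem_solW.1 (tripodLaw_fan l)

end ClassWeights

/-! ### The outermost patterns are the non-crossing perfect matchings of `k + 1` points -/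

section Matchings

variable {nm : ℕ}

/-- **a NON-CROSSING PERFECT MATCHING** of `Fin n` (a link pattern of `n` boundary points), as a symmetric set of ordered pairs.
[cite: KhristoforovSmirnov2021, §1.2 (arXiv v1 p. 2: «matching marked points … Link Pattern»)] -/
structure IsNCMatching {n : ℕ} (N : Finset (Fin n × Fin n)) : Prop where
  symm : ∀ a b, (a, b) ∈ N → (b, a) ∈ N
  irrefl : ∀ a, (a, a) ∉ N
  perfect : ∀ a, ∃! b, (a, b) ∈ N
  planar : ∀ x y z w, (x, z) ∈ N → (y, w) ∈ N → ¬ CcwQuad x y z w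

/-- the type of non-crossing perfect matchings of `Fin n`. [cite: KhristoforovSmirnov2021, §1.2 (arXiv v1 p. 2)] -/
abbrev NCMatching (n : ℕ) : Type := {N : Finset (Fin n × Fin n) // IsNCMatching N}

/-- link patterns form a finite type. [cite: KhristoforovSmirnov2021, §1.2 (arXiv v1 p. 2)] -/
noncomputable instance instFintypeNCMatching {n : ℕ} : Fintype (NCMatching n) := Fintype.ofFinite _

/-- depth `0` unfolded: no pair encloses the partner. [cite: KhristoforovSmirnov2021, §1.2 (arXiv v1 p. 2)] -/
theorem depth_eq_zero_iff {j : Fin nm} {L : Finset (Fin nm × Fin nm)} : depth j L = 0 ↔ ∀ cd ∈ L, ¬ (cd.1 < j ∧ j < cd.2) := by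
  rw [depth_eq_card_encl, Finset.card_eq_zero]
  unfold encl
  rw [Finset.filter_eq_empty_iff]

/-- lifting a relation on `Fin k` to `Fin (k+1)` along `castSucc`. [folklore] -/
def liftRel (L : Finset (Fin nm × Fin nm)) : Finset (Fin (nm + 1) × Fin (nm + 1)) :=
  L.image fun ab => (Fin.castSucc ab.1, Fin.castSucc ab.2)

/-- membership in the lift. [folklore] -/
private theorem mem_liftRel {L : Finset (Fin nm × Fin nm)} {x y : Fin (nm + 1)} :
    (x, y) ∈ liftRel L ↔ ∃ a b : Fin nm, (a, b) ∈ L ∧ Fin.castSucc a = x ∧ Fin.castSucc b = y := by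
  unfold liftRel
  rw [Finset.mem_image]
  constructor
  · rintro ⟨⟨a, b⟩, hab, h⟩
    exact ⟨a, b, hab, (Prod.mk.inj h).1, (Prod.mk.inj h).2⟩
  · rintro ⟨a, b, hab, rfl, rfl⟩
    exact ⟨(a, b), hab, rfl⟩

/-- membership of lifted pairs in the lift. [folklore] -/
private theorem castSucc_mem_liftRel {L : Finset (Fin nm × Fin nm)} {a b : Fin nm} :
    (Fin.castSucc a, Fin.castSucc b) ∈ liftRel L ↔ (a, b) ∈ L := by
  rw [mem_liftRel]
  constructor
  · rintro ⟨a', b', h, ha, hb⟩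
    rw [Fin.castSucc_inj] at ha hb
    rw [← ha, ← hb]; exact h
  · exact fun h => ⟨a, b, h, rfl, rfl⟩

/-- lowering a relation on `Fin (k+1)` to `Fin k` (the pairs of lifted points). [folklore] -/
def lowerRel (N : Finset (Fin (nm + 1) × Fin (nm + 1))) : Finset (Fin nm × Fin nm) :=
  Finset.univ.filter fun ab => (Fin.castSucc ab.1, Fin.castSucc ab.2) ∈ N

/-- membership in the lowering. [folklore] -/
private theorem mem_lowerRel {N : Finset (Fin (nm + 1) × Fin (nm + 1))} {a b : Fin nm} :
    (a, b) ∈ lowerRel N ↔ (Fin.castSucc a, Fin.castSucc b) ∈ N := by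
  unfold lowerRel
  rw [Finset.mem_filter]
  exact ⟨fun h => h.2, fun h => ⟨Finset.mem_univ _, h⟩⟩

/-- **closing up an outermost pattern**: add the chord from the partner to a new last point.
[cite: KhristoforovSmirnov2021, §1.2 (arXiv v1 p. 2: «matching marked points»)] -/
def closeUpRel (j : Fin nm) (L : Finset (Fin nm × Fin nm)) : Finset (Fin (nm + 1) × Fin (nm + 1)) :=
  withPair (liftRel L) (Fin.castSucc j) (Fin.last nm)

/-- membership in the closed-up relation. [cite: KhristoforovSmirnov2021, §1.2 (arXiv v1 p. 2)] -/
private theorem mem_closeUpRel {j : Fin nm} {L : Finset (Fin nm × Fin nm)} {x y : Fin (nm + 1)} :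
    (x, y) ∈ closeUpRel j L ↔ (x = Fin.castSucc j ∧ y = Fin.last nm) ∨ (x = Fin.last nm ∧ y = Fin.castSucc j) ∨
      ∃ a b : Fin nm, (a, b) ∈ L ∧ Fin.castSucc a = x ∧ Fin.castSucc b = y := by
  unfold closeUpRel
  rw [mem_withPair, mem_liftRel]

/-- ★ **the closed-up relation of an outermost pattern is a non-crossing perfect matching of `k+1` points.**
[cite: KhristoforovSmirnov2021, §1.2 (arXiv v1 p. 2: «IP(ξ) is a union of disjoint paths, matching marked points»)] -/
theorem isNCMatching_closeUpRel {j : Fin nm} {L : Finset (Fin nm × Fin nm)} (hP : IsPattern j L) (h0 : depth j L = 0) :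
    IsNCMatching (closeUpRel j L) := by
  have hjl : Fin.castSucc j ≠ Fin.last nm := (Fin.castSucc_lt_last j).ne
  rw [depth_eq_zero_iff] at h0
  refine ⟨fun a b hab => ?_, fun a haa => ?_, fun a => ?_, fun x y z w hxz hyw => ?_⟩
  · rw [mem_closeUpRel] at hab ⊢
    rcases hab with ⟨rfl, rfl⟩ | ⟨rfl, rfl⟩ | ⟨a', b', h, rfl, rfl⟩
    · exact Or.inr (Or.inl ⟨rfl, rfl⟩)
    · exact Or.inl ⟨rfl, rfl⟩
    · exact Or.inr (Or.inr ⟨b', a', hP.symm _ _ h, rfl, rfl⟩)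
  · rw [mem_closeUpRel] at haa
    rcases haa with ⟨h1, h2⟩ | ⟨h1, h2⟩ | ⟨a', b', h, h1, h2⟩
    · exact hjl (h1.symm.trans h2)
    · exact hjl (h2.symm.trans h1)
    · rw [← h2, Fin.castSucc_inj] at h1
      exact hP.irrefl _ (h1 ▸ h)
  · rcases Fin.eq_castSucc_or_eq_last a with ⟨a', rfl⟩ | rfl
    · by_cases ha : a' = j
      · refine ⟨Fin.last nm, ?_, fun b hb => ?_⟩
        · show (Fin.castSucc a', Fin.last nm) ∈ closeUpRel j L
          rw [mem_closeUpRel, ha]; exact Or.inl ⟨rfl, rfl⟩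
        · have hb : (Fin.castSucc a', b) ∈ closeUpRel j L := hb
          rw [mem_closeUpRel] at hb
          rcases hb with ⟨-, e⟩ | ⟨e, -⟩ | ⟨a'', b'', h, e, -⟩
          · exact e
          · exact absurd e (Fin.castSucc_lt_last a').ne
          · rw [Fin.castSucc_inj] at e
            exact absurd (e.trans ha) (hP.off _ _ h)
      · obtain ⟨b', hb', huniq⟩ := hP.perfect a' ha
        refine ⟨Fin.castSucc b', ?_, fun b hb => ?_⟩
        · show (Fin.castSucc a', Fin.castSucc b') ∈ closeUpRel j L
          rw [mem_closeUpRel]; exact Or.inr (Or.inr ⟨a', b', hb', rfl, rfl⟩)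
        · have hb : (Fin.castSucc a', b) ∈ closeUpRel j L := hb
          rw [mem_closeUpRel] at hb
          rcases hb with ⟨e, -⟩ | ⟨e, -⟩ | ⟨a'', b'', h, e, rfl⟩
          · rw [Fin.castSucc_inj] at e; exact absurd e ha
          · exact absurd e (Fin.castSucc_lt_last a').ne
          · rw [Fin.castSucc_inj] at e
            subst e
            rw [huniq b'' h]
    · refine ⟨Fin.castSucc j, ?_, fun b hb => ?_⟩
      · show (Fin.last nm, Fin.castSucc j) ∈ closeUpRel j L
        rw [mem_closeUpRel]; exact Or.inr (Or.inl ⟨rfl, rfl⟩)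
      · have hb : (Fin.last nm, b) ∈ closeUpRel j L := hb
        rw [mem_closeUpRel] at hb
        rcases hb with ⟨e, -⟩ | ⟨-, e⟩ | ⟨a'', b'', -, e, -⟩
        · exact absurd e.symm hjl
        · exact e
        · exact absurd e (Fin.castSucc_lt_last _).ne
  · -- planarity: reduce to the values
    have hj := j.2
    rw [mem_closeUpRel] at hxz hyw
    rcases hyw with ⟨rfl, rfl⟩ | ⟨rfl, rfl⟩ | ⟨c, d, hcd, rfl, rfl⟩ <;>
      rcases hxz with ⟨rfl, rfl⟩ | ⟨rfl, rfl⟩ | ⟨a, b, hab, rfl, rfl⟩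
    all_goals first
      | exact fun hq => hP.planar a c b d hab hcd (by
          unfold CcwQuad at hq ⊢; simp only [Fin.lt_def, Fin.val_castSucc] at hq ⊢; exact hq)
      | skip
    all_goals
      unfold CcwQuad
      simp only [Fin.lt_def, Fin.val_castSucc, Fin.val_last]
    all_goals first
      | (have h1 := h0 _ hab; have h2 := h0 _ (hP.symm _ _ hab); have h3 := hP.ne_of_mem hab
         have h4 := hP.off _ _ hab; have h5 := hP.off₂ hab
         simp only [Fin.lt_def] at h1 h2
         have v3 := Fin.val_ne_of_ne h3; have v4 := Fin.val_ne_of_ne h4; have v5 := Fin.val_ne_of_ne h5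
         have := a.2; have := b.2; omega)
      | (have h1 := h0 _ hcd; have h2 := h0 _ (hP.symm _ _ hcd); have h3 := hP.ne_of_mem hcd
         have h4 := hP.off _ _ hcd; have h5 := hP.off₂ hcd
         simp only [Fin.lt_def] at h1 h2
         have v3 := Fin.val_ne_of_ne h3; have v4 := Fin.val_ne_of_ne h4; have v5 := Fin.val_ne_of_ne h5
         have := c.2; have := d.2; omega)
      | omega

/-- the last point's partner in a matching of `k+1` points. [cite: KhristoforovSmirnov2021, §1.2 (arXiv v1 p. 2)] -/
private theorem exists_lastPartner {N : Finset (Fin (nm + 1) × Fin (nm + 1))} (hN : IsNCMatching N) :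
    ∃ j : Fin nm, (Fin.last nm, Fin.castSucc j) ∈ N := by
  obtain ⟨b, hb, -⟩ := hN.perfect (Fin.last nm)
  have hbl : b ≠ Fin.last nm := fun e => hN.irrefl _ (e ▸ hb)
  exact ⟨b.castPred hbl, by rw [Fin.castSucc_castPred]; exact hb⟩

/-- **the partner of the new last point.** [cite: KhristoforovSmirnov2021, §1.2 (arXiv v1 p. 2)] -/
noncomputable def lastPartner {N : Finset (Fin (nm + 1) × Fin (nm + 1))} (hN : IsNCMatching N) : Fin nm :=
  Classical.choose (exists_lastPartner hN)

/-- Auxiliary. [cite: KhristoforovSmirnov2021, §1.2 (arXiv v1 p. 2)] -/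
theorem lastPartner_mem {N : Finset (Fin (nm + 1) × Fin (nm + 1))} (hN : IsNCMatching N) :
    (Fin.last nm, Fin.castSucc (lastPartner hN)) ∈ N :=
  Classical.choose_spec (exists_lastPartner hN)

/-- the last point has only this partner. [cite: KhristoforovSmirnov2021, §1.2 (arXiv v1 p. 2)] -/
theorem eq_lastPartner {N : Finset (Fin (nm + 1) × Fin (nm + 1))} (hN : IsNCMatching N) {a : Fin nm}
    (ha : (Fin.castSucc a, Fin.last nm) ∈ N) : a = lastPartner hN :=
  Fin.castSucc_injective _ ((hN.perfect (Fin.last nm)).unique (hN.symm _ _ ha) (lastPartner_mem hN))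

/-- ★ **opening up a matching of `k+1` points gives an outermost pattern**: partner = the last point's partner, relation = the
other chords. [cite: KhristoforovSmirnov2021, §1.2 (arXiv v1 p. 2: «IP(ξ) is a union of disjoint paths, matching marked points»)] -/
theorem isPattern_lowerRel {N : Finset (Fin (nm + 1) × Fin (nm + 1))} (hN : IsNCMatching N) :
    IsPattern (lastPartner hN) (lowerRel N) := by
  have hlast := lastPartner_mem hN
  refine ⟨fun a b hab => ?_, fun a haa => ?_, fun a b hab => ?_, fun a ha => ?_, fun x y z w hxz hyw => ?_⟩
  · rw [mem_lowerRel] at hab ⊢; exact hN.symm _ _ hab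
  · rw [mem_lowerRel] at haa; exact hN.irrefl _ haa
  · rw [mem_lowerRel] at hab
    intro e
    rw [e] at hab
    have := (hN.perfect _).unique hab (hN.symm _ _ hlast)
    exact (Fin.castSucc_lt_last b).ne this
  · obtain ⟨b, hb, huniq⟩ := hN.perfect (Fin.castSucc a)
    have hbl : b ≠ Fin.last nm := fun e => ha (eq_lastPartner hN (e ▸ hb))
    refine ⟨b.castPred hbl, ?_, fun b' hb' => ?_⟩
    · show (a, b.castPred hbl) ∈ lowerRel N
      rw [mem_lowerRel, Fin.castSucc_castPred]; exact hb
    · have hb' : (a, b') ∈ lowerRel N := hb'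
      rw [mem_lowerRel] at hb'
      rw [← Fin.castPred_castSucc (i := b') (Fin.castSucc_lt_last b').ne]
      simp_rw [huniq _ hb']
  · rw [mem_lowerRel] at hxz hyw
    intro hq
    refine hN.planar _ _ _ _ hxz hyw ?_
    unfold CcwQuad at hq ⊢
    simp only [Fin.lt_def, Fin.val_castSucc] at hq ⊢
    exact hq

/-- the opened-up pattern is outermost. [cite: KhristoforovSmirnov2021, §1.2 (arXiv v1 p. 2)] -/
theorem depth_lowerRel {N : Finset (Fin (nm + 1) × Fin (nm + 1))} (hN : IsNCMatching N) :
    depth (lastPartner hN) (lowerRel N) = 0 := by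
  rw [depth_eq_zero_iff]
  rintro ⟨c, d⟩ hcd ⟨h1, h2⟩
  rw [mem_lowerRel] at hcd
  refine hN.planar _ _ _ _ hcd (hN.symm _ _ (lastPartner_mem hN)) (Or.inl ⟨?_, ?_, Fin.castSucc_lt_last d⟩)
  · exact Fin.castSucc_lt_castSucc_iff.2 h1
  · exact Fin.castSucc_lt_castSucc_iff.2 h2

/-- **closing up**, as a map from outermost patterns to link patterns of `k+1` points.
[cite: KhristoforovSmirnov2021, §1.2 (arXiv v1 p. 2)] -/
def closeUp (q : Pat₀ nm) : NCMatching (nm + 1) :=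
  ⟨closeUpRel q.1.1.1 q.1.1.2, isNCMatching_closeUpRel q.1.2 q.2⟩

/-- **opening up**, as a map from link patterns of `k+1` points to outermost patterns.
[cite: KhristoforovSmirnov2021, §1.2 (arXiv v1 p. 2)] -/
noncomputable def openUp (N : NCMatching (nm + 1)) : Pat₀ nm :=
  ⟨⟨(lastPartner N.2, lowerRel N.1), isPattern_lowerRel N.2⟩, depth_lowerRel N.2⟩

/-- opening up a closed-up pattern. [cite: KhristoforovSmirnov2021, §1.2 (arXiv v1 p. 2)] -/
theorem openUp_closeUp (q : Pat₀ nm) : openUp (closeUp q) = q := by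
  have hP : IsPattern q.1.1.1 q.1.1.2 := q.1.2
  have hN : IsNCMatching (closeUpRel q.1.1.1 q.1.1.2) := isNCMatching_closeUpRel q.1.2 q.2
  -- the partner
  have hj : lastPartner hN = q.1.1.1 :=
    (eq_lastPartner hN (by rw [mem_closeUpRel]; exact Or.inl ⟨rfl, rfl⟩)).symm
  -- the relation
  have hL : lowerRel (closeUpRel q.1.1.1 q.1.1.2) = q.1.1.2 := by
    ext ⟨a, b⟩
    rw [mem_lowerRel, mem_closeUpRel]
    constructor
    · rintro (⟨-, e⟩ | ⟨e, -⟩ | ⟨a', b', h, ha, hb⟩)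
      · exact absurd e (Fin.castSucc_lt_last b).ne
      · exact absurd e (Fin.castSucc_lt_last a).ne
      · rw [Fin.castSucc_inj] at ha hb
        rw [← ha, ← hb]; exact h
    · exact fun h => Or.inr (Or.inr ⟨a, b, h, rfl, rfl⟩)
  apply Subtype.ext
  apply Subtype.ext
  show (lastPartner hN, lowerRel (closeUpRel q.1.1.1 q.1.1.2)) = q.1.1
  rw [hj, hL]

/-- closing up an opened-up matching. [cite: KhristoforovSmirnov2021, §1.2 (arXiv v1 p. 2)] -/
theorem closeUp_openUp (N : NCMatching (nm + 1)) : closeUp (openUp N) = N := by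
  have hN : IsNCMatching N.1 := N.2
  have hlast := lastPartner_mem hN
  apply Subtype.ext
  show closeUpRel (lastPartner hN) (lowerRel N.1) = N.1
  ext ⟨x, y⟩
  rw [mem_closeUpRel]
  constructor
  · rintro (⟨rfl, rfl⟩ | ⟨rfl, rfl⟩ | ⟨a, b, h, rfl, rfl⟩)
    · exact hN.symm _ _ hlast
    · exact hlast
    · exact mem_lowerRel.1 h
  · intro hxy
    rcases Fin.eq_castSucc_or_eq_last x with ⟨a, rfl⟩ | rfl
    · rcases Fin.eq_castSucc_or_eq_last y with ⟨b, rfl⟩ | rfl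
      · exact Or.inr (Or.inr ⟨a, b, mem_lowerRel.2 hxy, rfl, rfl⟩)
      · exact Or.inl ⟨by rw [eq_lastPartner hN hxy], rfl⟩
    · rcases Fin.eq_castSucc_or_eq_last y with ⟨b, rfl⟩ | rfl
      · exact Or.inr (Or.inl ⟨rfl, by rw [eq_lastPartner hN (hN.symm _ _ hxy)]⟩)
      · exact absurd hxy (hN.irrefl _)

/-- ★★ **THE OUTERMOST PATTERNS ARE THE LINK PATTERNS OF `k+1` POINTS** (close up the partner to a new last point).
[cite: KhristoforovSmirnov2021, §1.2 (arXiv v1 p. 2: «matching marked points … Link Pattern»)] -/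
noncomputable def pat₀EquivNCMatching (nm : ℕ) : Pat₀ nm ≃ NCMatching (nm + 1) where
  toFun := closeUp
  invFun := openUp
  left_inv := openUp_closeUp
  right_inv := closeUp_openUp

/-- the count of outermost patterns. [cite: KhristoforovSmirnov2021, §1.2 (arXiv v1 p. 2)] -/
theorem card_pat₀_eq_card_ncMatching (nm : ℕ) : Fintype.card (Pat₀ nm) = Fintype.card (NCMatching (nm + 1)) :=
  Fintype.card_congr (pat₀EquivNCMatching nm)

/-- ★★★ **DIMENSION OF THE TRIPOD-LAW SOLUTION SPACE = NUMBER OF LINK PATTERNS OF `k+1` POINTS** (for `k = 2l+1` this is the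
Catalan number `C_{l+1}` — bookkeeping, see the header; the count itself is not evaluated here).
[cite: KhristoforovSmirnov2021, §2 Lemma 4, proof and Fig. 3 (p. 4); §1.2 (p. 2)] -/
theorem finrank_solW_eq_card_ncMatching (nm : ℕ) : Module.finrank ℂ (solW nm) = Fintype.card (NCMatching (nm + 1)) := by
  rw [finrank_solW, card_pat₀_eq_card_ncMatching]

end Matchings

/-! ### The explicit basis and the fan member -/

section Basis

variable {nm : ℕ}

/-- **the basis solution of one outermost pattern** `q`: `extend` of the indicator of `q` (compared as (partner, relation) pairs).
[cite: KhristoforovSmirnov2021, §2 Definition 3 and Lemma 4 (arXiv v1 p. 4)] -/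
noncomputable def basisW (q : Pat₀ nm) : Pat nm → ℂ := extend fun q' => if q'.1.1 = q.1.1 then 1 else 0

/-- the basis solution solves the tripod recursion. [cite: KhristoforovSmirnov2021, §2 Lemma 4 (arXiv v1 p. 4)] -/
theorem basisW_mem_solW (q : Pat₀ nm) : basisW q ∈ solW nm := extend_mem_solW _

/-- its outermost values: the indicator of `q`. [cite: KhristoforovSmirnov2021, §2 Lemma 4 (arXiv v1 p. 4)] -/
theorem basisW_of_zero (q : Pat₀ nm) (p : Pat nm) (h : p.pdepth = 0) : basisW q p = if p.1 = q.1.1 then 1 else 0 := by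
  unfold basisW
  rw [extend_of_zero _ _ h]

/-- its observable is discretely holomorphic on every `k`-marked domain. [cite: KhristoforovSmirnov2021, §2 Lemma 4 eq. (3) (arXiv v1 p. 4)] -/
theorem holomorphicW_basisW (D : TriMarkedDomain nm) (q : Pat₀ nm) : HolomorphicW D (classWt (basisW q)) :=
  holomorphicW_classWt D (basisW_mem_solW q)

/-- ★ **every solution is the combination of the basis solutions weighted by its outermost values** (finite sum over `Pat₀ k`).
[cite: KhristoforovSmirnov2021, §2 Lemma 4 (arXiv v1 p. 4)] -/
theorem eq_sum_basisW_of_mem_solW {w : Pat nm → ℂ} (hw : w ∈ solW nm) : w = ∑ q : Pat₀ nm, w q.1 • basisW q := by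
  classical
  refine eq_of_mem_solW hw (Submodule.sum_mem _ fun q _ => Submodule.smul_mem _ _ (basisW_mem_solW q)) fun p hp => ?_
  simp only [Finset.sum_apply, Pi.smul_apply, smul_eq_mul]
  rw [Finset.sum_eq_single (⟨p, hp⟩ : Pat₀ nm)]
  · rw [basisW_of_zero _ _ hp, if_pos rfl, mul_one]
  · intro q _ hq
    rw [basisW_of_zero _ _ hp, if_neg, mul_zero]
    intro e
    exact hq (Subtype.ext (Subtype.ext e.symm))
  · intro h; exact absurd (Finset.mem_univ _) h

variable {l : ℕ}

/-- membership in the fan relation with apex `0` (the RAINBOW): the pairs `{i, 2l+1−i}`. [cite: KhristoforovSmirnov2021, §1.2 (arXiv v1 p. 2)] -/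
private theorem mem_fanRel_zero {a b : Fin (2 * l + 1)} : (a, b) ∈ fanRel l 0 ↔ a.val + b.val = 2 * l + 1 := by
  rw [mem_fanRel]
  have := a.2; have := b.2
  omega

/-- **the rainbow is an outermost pattern**: `(0; {i, 2l+1−i})`. [cite: KhristoforovSmirnov2021, §1.2 (arXiv v1 p. 2: the link pattern)] -/
theorem isPattern_fanRel_zero (l : ℕ) : IsPattern (⟨0, Nat.succ_pos _⟩ : Fin (2 * l + 1)) (fanRel l 0) := by
  refine ⟨fun a b hab => ?_, fun a haa => ?_, fun a b hab => ?_, fun a ha => ?_, fun x y z w hxz hyw => ?_⟩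
  · rw [mem_fanRel_zero] at hab ⊢; omega
  · rw [mem_fanRel_zero] at haa; omega
  · rw [mem_fanRel_zero] at hab
    intro e
    have h1 : a.val = 0 := by rw [e]
    have := b.2
    omega
  · have ha' : a.val ≠ 0 := fun e => ha (Fin.ext e)
    have hlt : 2 * l + 1 - a.val < 2 * l + 1 := by omega
    refine ⟨⟨2 * l + 1 - a.val, hlt⟩, ?_, fun b hb => ?_⟩
    · show (a, (⟨2 * l + 1 - a.val, hlt⟩ : Fin (2 * l + 1))) ∈ fanRel l 0
      rw [mem_fanRel_zero]
      simp only
      omega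
    · have hb : (a, b) ∈ fanRel l 0 := hb
      rw [mem_fanRel_zero] at hb
      exact Fin.ext (by simp only; omega)
  · rw [mem_fanRel_zero] at hxz hyw
    unfold CcwQuad
    simp only [Fin.lt_def]
    omega

/-- the rainbow has depth `0` at its apex `0`. [cite: KhristoforovSmirnov2021, §1.2 (arXiv v1 p. 2)] -/
theorem depth_fanRel_zero (l : ℕ) : depth (⟨0, Nat.succ_pos _⟩ : Fin (2 * l + 1)) (fanRel l 0) = 0 := by
  rw [depth_eq_zero_iff]
  rintro ⟨c, d⟩ - ⟨hc, -⟩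
  exact absurd hc (Nat.not_lt_zero _)

/-- **the RAINBOW outermost pattern** of `2l+1` corners. [cite: KhristoforovSmirnov2021, §1.2 (arXiv v1 p. 2)] -/
def rainbow (l : ℕ) : Pat₀ (2 * l + 1) := ⟨⟨((⟨0, Nat.succ_pos _⟩ : Fin (2 * l + 1)), fanRel l 0), isPattern_fanRel_zero l⟩, depth_fanRel_zero l⟩

/-- a fan pattern with a positive apex is not outermost: the chord `{0, 2l}` encloses the apex.
[cite: KhristoforovSmirnov2021, §1.2 (arXiv v1 p. 2)] -/
private theorem depth_fanRel_ne_zero {j : Fin (2 * l + 1)} (hj : j.val ≤ l) (hj0 : j.val ≠ 0) : depth j (fanRel l j.val) ≠ 0 := by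
  rw [Ne, depth_eq_zero_iff, not_forall]
  have h0 : 0 < 2 * l + 1 := Nat.succ_pos _
  have h2l : 2 * l < 2 * l + 1 := Nat.lt_succ_self _
  refine ⟨(⟨0, h0⟩, ⟨2 * l, h2l⟩), ?_⟩
  rw [Classical.not_imp, not_not]
  refine ⟨?_, Fin.lt_def.2 (by simp only; omega), Fin.lt_def.2 (by simp only; omega)⟩
  rw [mem_fanRel]
  left
  simp only
  omega

/-- ★★ **THE FAN IS THE RAINBOW'S BASIS OBSERVABLE** (up to sign): on the patterns, the tree's fan weight `fanWt l` is `−basisW (rainbow l)`.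
[cite: KhristoforovSmirnov2021, §2 Definition 3 and Lemma 4 (arXiv v1 p. 4)] -/
theorem restrictW_fanWt_eq_neg_basisW (l : ℕ) : restrictW (fanWt l) = -basisW (rainbow l) := by
  refine eq_of_mem_solW (restrictW_fanWt_mem_solW l) ((solW _).neg_mem (basisW_mem_solW _)) fun p hp => ?_
  rw [Pi.neg_apply, basisW_of_zero _ _ hp]
  show fanWt l p.1.1 p.1.2 = _
  by_cases heq : p.1 = (rainbow l).1.1
  · rw [if_pos heq]
    have h1 : p.1.1 = ⟨0, Nat.succ_pos _⟩ := congrArg Prod.fst heq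
    have h2 : p.1.2 = fanRel l 0 := congrArg Prod.snd heq
    rw [fanWt_eq_of_eq (by rw [h1]; exact Nat.zero_le _) (by rw [h2, h1])]
    have h3 : p.1.1.val = 0 := by rw [h1]
    rw [h3, pow_zero]
  · rw [if_neg heq, neg_zero]
    by_contra hne
    obtain ⟨hjl, hL⟩ := fanWt_ne_zero_iff hne
    by_cases hj0 : p.1.1.val = 0
    · apply heq
      refine Prod.ext (Fin.ext hj0) ?_
      show p.1.2 = fanRel l 0
      rw [hL, hj0]
    · have hd := depth_fanRel_ne_zero hjl hj0
      rw [← hL] at hd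
      exact hd hp

end Basis

/-! ### Counting: the patterns of positive depth are the pictures -/

section Counting

variable {nm : ℕ}

/-- pictures (up to rotation) form a finite type. [cite: KhristoforovSmirnov2021, §2 Lemma 4, proof and Fig. 3 (arXiv v1 p. 4)] -/
noncomputable instance instFintypePic : Fintype (Pic nm) := by unfold Pic; exact Fintype.ofFinite _

/-- **the mid pattern of a picture, as a pattern.** [cite: KhristoforovSmirnov2021, §2 Lemma 4, proof and Fig. 3 (arXiv v1 p. 4)] -/
noncomputable def Pic.toPat (P : Pic nm) : Pat nm := ⟨P.midPat, P.pic.rotate.isPattern_lo⟩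

/-- its depth is the picture's base depth plus one. [cite: KhristoforovSmirnov2021, §2 Lemma 4, proof and Fig. 3 (arXiv v1 p. 4)] -/
theorem Pic.pdepth_toPat (P : Pic nm) : P.toPat.pdepth = P.pdepth + 1 := P.depth_midPat

/-- distinct pictures have distinct mid patterns (the tree's `midPat_injective`). [cite: KhristoforovSmirnov2021, §1.2 (arXiv v1 p. 2)] -/
theorem Pic.toPat_injective : Function.Injective (Pic.toPat : Pic nm → Pat nm) :=
  fun _ _ h => Pic.midPat_injective (congrArg Subtype.val h)

/-- **the picture of a pattern of positive depth**: the increasing picture on its innermost chord.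
[cite: KhristoforovSmirnov2021, §2 Lemma 4, proof and Fig. 3 (arXiv v1 p. 4)] -/
noncomputable def Pat.toPic (p : Pat nm) (h : 0 < p.pdepth) : Pic nm :=
  ⟨(((innerPair p.1.1 p.1.2).1, p.1.1, (innerPair p.1.1 p.1.2).2), strip p.1.2 (innerPair p.1.1 p.1.2).1 (innerPair p.1.1 p.1.2).2),
    ⟨(innerPair_mem h).2.1, (innerPair_mem h).2.2, tripodPicture_of_pattern p.2 h⟩⟩

/-- the mid pattern of that picture is the pattern. [cite: KhristoforovSmirnov2021, §2 Lemma 4, proof and Fig. 3 (arXiv v1 p. 4)] -/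
theorem Pat.toPat_toPic (p : Pat nm) (h : 0 < p.pdepth) : (p.toPic h).toPat = p :=
  Subtype.ext (Prod.ext rfl (withPair_strip_inner p.2 h))

/-- ★ **THE PICTURES ARE THE PATTERNS OF POSITIVE DEPTH** (one tripod relation per non-outermost unknown).
[cite: KhristoforovSmirnov2021, §2 Lemma 4, proof and Fig. 3 (arXiv v1 p. 4); §1.2 (p. 2)] -/
noncomputable def picEquivPosDepth (nm : ℕ) : Pic nm ≃ {p : Pat nm // 0 < p.pdepth} where
  toFun P := ⟨P.toPat, by rw [P.pdepth_toPat]; exact Nat.succ_pos _⟩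
  invFun p := p.1.toPic p.2
  left_inv P := Pic.toPat_injective (Pat.toPat_toPic P.toPat _)
  right_inv p := Subtype.ext (Pat.toPat_toPic p.1 p.2)

/-- ★ **COUNT**: `#patterns = #outermost patterns + #pictures` — the tripod law has exactly one relation per non-free unknown.
[cite: KhristoforovSmirnov2021, §2 Lemma 4, proof and Fig. 3 (arXiv v1 p. 4); §1.2 (p. 2)] -/
theorem card_pat_eq_card_pat₀_add_card_pic (nm : ℕ) : Fintype.card (Pat nm) = Fintype.card (Pat₀ nm) + Fintype.card (Pic nm) := by
  classical
  have e : {p : Pat nm // ¬ p.pdepth = 0} ≃ Pic nm :=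
    (Equiv.subtypeEquivRight fun p => Nat.pos_iff_ne_zero.symm).trans (picEquivPosDepth nm).symm
  rw [← Fintype.card_congr (Equiv.sumCompl fun p : Pat nm => p.pdepth = 0), Fintype.card_sum, Fintype.card_congr e]

/-- ★★ hence **dimension + #relations = #unknowns**: `finrank (solW k) + #Pic k = #Pat k` — with the tree's `linearIndependent_relVec` (the
relations are independent) this is rank–nullity for the tripod system, obtained here without linear algebra on the relation matrix.
[cite: KhristoforovSmirnov2021, §2 Lemma 4, proof and Fig. 3 (arXiv v1 p. 4)] -/
theorem finrank_solW_add_card_pic (nm : ℕ) : Module.finrank ℂ (solW nm) + Fintype.card (Pic nm) = Fintype.card (Pat nm) := by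
  rw [finrank_solW, card_pat_eq_card_pat₀_add_card_pic]

end Counting

/-! ### The basis as a Mathlib `Basis`, and non-triviality -/

section MathlibBasis

variable {nm : ℕ}

variable (nm) in
/-- **the basis of the solution space indexed by the outermost patterns** (Mathlib `Basis` object, from `solWEquiv`).
[cite: KhristoforovSmirnov2021, §2 Lemma 4 (arXiv v1 p. 4)] -/
noncomputable def solWBasis : Module.Basis (Pat₀ nm) ℂ (solW nm) := Module.Basis.ofEquivFun (solWEquiv nm)

/-- its vectors are the basis solutions `basisW q`. [cite: KhristoforovSmirnov2021, §2 Lemma 4 (arXiv v1 p. 4)] -/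
theorem coe_solWBasis (q : Pat₀ nm) : ((solWBasis nm q : solW nm) : Pat nm → ℂ) = basisW q := by
  classical
  rw [solWBasis, Module.Basis.coe_ofEquivFun]
  show extend (Pi.single q 1) = basisW q
  unfold basisW
  congr 1
  funext q'
  rw [Pi.single_apply]
  by_cases h : q' = q
  · rw [if_pos h, if_pos (by rw [h])]
  · rw [if_neg h, if_neg (fun e => h (Subtype.ext (Subtype.ext e)))]

/-- **non-triviality**: for an odd number `2l+1` of corners the solution space is non-zero (the rainbow is an outermost pattern).
[cite: KhristoforovSmirnov2021, §2 Lemma 4 (arXiv v1 p. 4)] -/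
theorem finrank_solW_pos (l : ℕ) : 0 < Module.finrank ℂ (solW (2 * l + 1)) := by
  rw [finrank_solW]
  exact Fintype.card_pos_iff.2 ⟨rainbow l⟩

end MathlibBasis

/-! ### The recursion unrolled: descent words -/

section DescentWords

variable {nm : ℕ}

/-- **descending along a word** of lo (`false`) / hi (`true`) steps of length `n`. [cite: KhristoforovSmirnov2021, §2 Lemma 4 (arXiv v1 p. 4)] -/
noncomputable def descendN : (n : ℕ) → Pat nm → (Fin n → Bool) → Pat nm
  | 0, p, _ => p
  | n + 1, p, ε => descendN n (if ε 0 then p.hi else p.lo) (Fin.tail ε)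

/-- **the coefficient of a word**: `−τ` per hi step, `−τ²` per lo step. [cite: KhristoforovSmirnov2021, §2 Lemma 4 (arXiv v1 p. 4)] -/
noncomputable def coefN : (n : ℕ) → (Fin n → Bool) → ℂ
  | 0, _ => 1
  | n + 1, ε => (if ε 0 then -tau else -tau ^ 2) * coefN n (Fin.tail ε)

/-- a word of full length descends to an outermost pattern. [cite: KhristoforovSmirnov2021, §2 Lemma 4 (arXiv v1 p. 4)] -/
theorem pdepth_descendN : ∀ (n : ℕ) (p : Pat nm) (ε : Fin n → Bool), p.pdepth = n → (descendN n p ε).pdepth = 0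
  | 0, p, ε, h => h
  | n + 1, p, ε, h => by
    have hp : 0 < p.pdepth := by rw [h]; exact Nat.succ_pos _
    unfold descendN
    refine pdepth_descendN n _ _ ?_
    by_cases hb : ε 0
    · rw [if_pos hb]; have := p.pdepth_hi hp; omega
    · rw [if_neg hb]; have := p.pdepth_lo hp; omega

/-- ★★ **THE RECURSION UNROLLED**: a solution's value at a pattern of depth `n` is the signed-`τ`-power combination of its OUTERMOST values at the
ends of the `2^n` descent words: `w p = Σ_{ε : Fin n → Bool} coefN ε · w (descendN n p ε)`.
[cite: KhristoforovSmirnov2021, §2 Lemma 4, proof and Fig. 3 (arXiv v1 p. 4)] -/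
theorem eq_sum_descendN {w : Pat nm → ℂ} (hw : w ∈ solW nm) :
    ∀ (n : ℕ) (p : Pat nm), p.pdepth = n → w p = ∑ ε : Fin n → Bool, coefN n ε * w (descendN n p ε)
  | 0, p, _ => by simp [coefN, descendN]
  | n + 1, p, h => by
    have hp : 0 < p.pdepth := by rw [h]; exact Nat.succ_pos _
    have hlo : p.lo.pdepth = n := by have := p.pdepth_lo hp; omega
    have hhi : p.hi.pdepth = n := by have := p.pdepth_hi hp; omega
    rw [hw p hp, eq_sum_descendN hw n p.lo hlo, eq_sum_descendN hw n p.hi hhi]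
    -- split the words of length `n + 1` by their first letter
    have hsplit : ∑ ε : Fin (n + 1) → Bool, coefN (n + 1) ε * w (descendN (n + 1) p ε) =
        ∑ x : Bool × (Fin n → Bool), coefN (n + 1) (Fin.cons x.1 x.2) * w (descendN (n + 1) p (Fin.cons x.1 x.2)) :=
      Fintype.sum_equiv (Fin.consEquiv fun _ : Fin (n + 1) => Bool).symm _ _ fun ε => by
        simp only [Fin.consEquiv_symm_apply, Fin.cons_self_tail]
    rw [hsplit, Fintype.sum_prod_type, Fintype.sum_bool]
    simp only [descendN, coefN, Fin.cons_zero, Fin.tail_cons, if_true, Bool.false_eq_true, if_false]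
    rw [Finset.mul_sum, Finset.mul_sum, sub_eq_add_neg, ← Finset.sum_neg_distrib, add_comm]
    congr 1 <;> exact Finset.sum_congr rfl fun x _ => by ring

/-- ★ **CLOSED FORM OF THE BASIS**: `basisW q p = Σ_{ε : descendN p ε = q} coefN ε` — the basis solution at `p` collects the signed `τ`-powers of
the descent words from `p` ending at `q` (exact data k ≤ 9: at most one word ends at `q`).
[cite: KhristoforovSmirnov2021, §2 Lemma 4, proof and Fig. 3 (arXiv v1 p. 4)] -/
theorem basisW_eq_sum_descendN (q : Pat₀ nm) (p : Pat nm) :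
    basisW q p = ∑ ε : Fin p.pdepth → Bool, if (descendN p.pdepth p ε).1 = q.1.1 then coefN p.pdepth ε else 0 := by
  rw [eq_sum_descendN (basisW_mem_solW q) p.pdepth p rfl]
  refine Finset.sum_congr rfl fun ε _ => ?_
  rw [basisW_of_zero q _ (pdepth_descendN _ p ε rfl)]
  split_ifs <;> simp

end DescentWords

/-! ### Descent words are injective: frozen chords -/

section WordInjective

variable {nm : ℕ}

/-- `(c, d)` ENCLOSES `j` in one of its two orientations. [cite: KhristoforovSmirnov2021, §1.2 (arXiv v1 p. 2)] -/
def Encl (j c d : Fin nm) : Prop := (c < j ∧ j < d) ∨ (d < j ∧ j < c)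

/-- **frozen chords, lo step**: a chord of a pattern not enclosing the partner survives the lo descent and does not enclose the new partner.
[cite: KhristoforovSmirnov2021, §2 Lemma 4, proof and Fig. 3 (arXiv v1 p. 4)] -/
theorem frozen_loDesc {j : Fin nm} {L : Finset (Fin nm × Fin nm)} (hP : IsPattern j L) (h : 0 < depth j L) {c d : Fin nm}
    (hcd : (c, d) ∈ L) (hne : ¬ Encl j c d) :
    (c, d) ∈ (loDesc j L).2 ∧ ¬ Encl (loDesc j L).1 c d := by
  obtain ⟨hmem, hα, hγ⟩ := innerPair_mem h
  have hne1 : ¬ (c = (innerPair j L).1 ∧ d = (innerPair j L).2) := fun e => hne (Or.inl ⟨e.1 ▸ hα, e.2 ▸ hγ⟩)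
  have hne2 : ¬ (c = (innerPair j L).2 ∧ d = (innerPair j L).1) := fun e => hne (Or.inr ⟨e.2 ▸ hα, e.1 ▸ hγ⟩)
  obtain ⟨hcα, hcγ, hdα, hdγ, hcj, hdj, hside, -⟩ := pair_position hP h hcd hne1 hne2
  refine ⟨?_, ?_⟩
  · unfold loDesc
    rw [mem_withPair, mem_strip]
    exact Or.inr (Or.inr ⟨hcd, hne1, hne2⟩)
  · unfold loDesc Encl
    unfold Encl at hne
    simp only
    simp only [Fin.lt_def] at *
    have v1 := Fin.val_ne_of_ne hcα; have v2 := Fin.val_ne_of_ne hcγ; have v3 := Fin.val_ne_of_ne hdα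
    have v4 := Fin.val_ne_of_ne hdγ; have v5 := Fin.val_ne_of_ne hcj; have v6 := Fin.val_ne_of_ne hdj
    omega

/-- **frozen chords, hi step.** [cite: KhristoforovSmirnov2021, §2 Lemma 4, proof and Fig. 3 (arXiv v1 p. 4)] -/
theorem frozen_hiDesc {j : Fin nm} {L : Finset (Fin nm × Fin nm)} (hP : IsPattern j L) (h : 0 < depth j L) {c d : Fin nm}
    (hcd : (c, d) ∈ L) (hne : ¬ Encl j c d) :
    (c, d) ∈ (hiDesc j L).2 ∧ ¬ Encl (hiDesc j L).1 c d := by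
  obtain ⟨hmem, hα, hγ⟩ := innerPair_mem h
  have hne1 : ¬ (c = (innerPair j L).1 ∧ d = (innerPair j L).2) := fun e => hne (Or.inl ⟨e.1 ▸ hα, e.2 ▸ hγ⟩)
  have hne2 : ¬ (c = (innerPair j L).2 ∧ d = (innerPair j L).1) := fun e => hne (Or.inr ⟨e.2 ▸ hα, e.1 ▸ hγ⟩)
  obtain ⟨hcα, hcγ, hdα, hdγ, hcj, hdj, hside, -⟩ := pair_position hP h hcd hne1 hne2
  refine ⟨?_, ?_⟩
  · unfold hiDesc
    rw [mem_withPair, mem_strip]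
    exact Or.inr (Or.inr ⟨hcd, hne1, hne2⟩)
  · unfold hiDesc Encl
    unfold Encl at hne
    simp only
    simp only [Fin.lt_def] at *
    have v1 := Fin.val_ne_of_ne hcα; have v2 := Fin.val_ne_of_ne hcγ; have v3 := Fin.val_ne_of_ne hdα
    have v4 := Fin.val_ne_of_ne hdγ; have v5 := Fin.val_ne_of_ne hcj; have v6 := Fin.val_ne_of_ne hdj
    omega

/-- the chord CREATED by the lo step, `{j, γ}`, does not enclose the new partner `α`. [cite: KhristoforovSmirnov2021, §2 Lemma 4 (arXiv v1 p. 4)] -/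
theorem created_loDesc {j : Fin nm} {L : Finset (Fin nm × Fin nm)} (h : 0 < depth j L) :
    (j, (innerPair j L).2) ∈ (loDesc j L).2 ∧ ¬ Encl (loDesc j L).1 j (innerPair j L).2 := by
  obtain ⟨-, hα, hγ⟩ := innerPair_mem h
  refine ⟨by unfold loDesc; rw [mem_withPair]; exact Or.inl ⟨rfl, rfl⟩, ?_⟩
  unfold loDesc Encl
  simp only
  exact fun hq => hq.elim (fun e => lt_asymm hα e.1) (fun e => lt_asymm (hα.trans hγ) e.1)

/-- the chord CREATED by the hi step, `{α, j}`, does not enclose the new partner `γ`. [cite: KhristoforovSmirnov2021, §2 Lemma 4 (arXiv v1 p. 4)] -/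
theorem created_hiDesc {j : Fin nm} {L : Finset (Fin nm × Fin nm)} (h : 0 < depth j L) :
    (j, (innerPair j L).1) ∈ (hiDesc j L).2 ∧ ¬ Encl (hiDesc j L).1 j (innerPair j L).1 := by
  obtain ⟨-, hα, hγ⟩ := innerPair_mem h
  refine ⟨by unfold hiDesc; rw [mem_withPair]; exact Or.inr (Or.inl ⟨rfl, rfl⟩), ?_⟩
  unfold hiDesc Encl
  simp only
  exact fun hq => hq.elim (fun e => lt_asymm (hα.trans hγ) e.2) (fun e => lt_asymm hγ e.2)

/-- **frozen chords survive every descent word.** [cite: KhristoforovSmirnov2021, §2 Lemma 4, proof and Fig. 3 (arXiv v1 p. 4)] -/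
theorem frozen_descendN {c d : Fin nm} :
    ∀ (n : ℕ) (p : Pat nm) (ε : Fin n → Bool), p.pdepth = n → (c, d) ∈ p.1.2 → ¬ Encl p.1.1 c d → (c, d) ∈ (descendN n p ε).1.2
  | 0, p, ε, _, hcd, _ => hcd
  | n + 1, p, ε, h, hcd, hne => by
    have hp : 0 < p.pdepth := by rw [h]; exact Nat.succ_pos _
    unfold descendN
    by_cases hb : ε 0
    · rw [if_pos hb]
      have hv := p.hi_val hp
      obtain ⟨h1, h2⟩ := frozen_hiDesc p.2 hp hcd hne
      refine frozen_descendN n p.hi (Fin.tail ε) (by have := p.pdepth_hi hp; omega) (by rw [hv]; exact h1) (by rw [hv]; exact h2)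
    · rw [if_neg hb]
      have hv := p.lo_val hp
      obtain ⟨h1, h2⟩ := frozen_loDesc p.2 hp hcd hne
      refine frozen_descendN n p.lo (Fin.tail ε) (by have := p.pdepth_lo hp; omega) (by rw [hv]; exact h1) (by rw [hv]; exact h2)

/-- ★★ **DISTINCT WORDS REACH DISTINCT PATTERNS**: `descendN n p` is injective on the words of full length `n = depth p`.
[cite: KhristoforovSmirnov2021, §2 Lemma 4, proof and Fig. 3 (arXiv v1 p. 4)] -/
theorem descendN_injective : ∀ (n : ℕ) (p : Pat nm), p.pdepth = n → Function.Injective (descendN n p)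
  | 0, p, _ => fun ε ε' _ => funext fun i => i.elim0
  | n + 1, p, h => by
    intro ε ε' heq
    have hp : 0 < p.pdepth := by rw [h]; exact Nat.succ_pos _
    have hlo : p.lo.pdepth = n := by have := p.pdepth_lo hp; omega
    have hhi : p.hi.pdepth = n := by have := p.pdepth_hi hp; omega
    unfold descendN at heq
    -- the partner of `j` in the final pattern tells the first letter
    have key : ε 0 = ε' 0 := by
      by_contra hne
      -- frozen created chords: lo branch keeps (j, γ), hi branch keeps (j, α)
      have hα := (innerPair_mem hp).2.1
      have hγ := (innerPair_mem hp).2.2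
      have hαγ : (innerPair p.1.1 p.1.2).1 ≠ (innerPair p.1.1 p.1.2).2 := ne_of_lt (hα.trans hγ)
      have clo : ∀ δ : Fin n → Bool, (p.1.1, (innerPair p.1.1 p.1.2).2) ∈ (descendN n p.lo δ).1.2 := fun δ => by
        obtain ⟨h1, h2⟩ := created_loDesc (j := p.1.1) (L := p.1.2) hp
        have hv := p.lo_val hp
        exact frozen_descendN n p.lo δ hlo (by rw [hv]; exact h1) (by rw [hv]; exact h2)
      have chi : ∀ δ : Fin n → Bool, (p.1.1, (innerPair p.1.1 p.1.2).1) ∈ (descendN n p.hi δ).1.2 := fun δ => by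
        obtain ⟨h1, h2⟩ := created_hiDesc (j := p.1.1) (L := p.1.2) hp
        have hv := p.hi_val hp
        exact frozen_descendN n p.hi δ hhi (by rw [hv]; exact h1) (by rw [hv]; exact h2)
      rcases Bool.eq_false_or_eq_true (ε 0) with h0 | h0 <;> rcases Bool.eq_false_or_eq_true (ε' 0) with h0' | h0'
      · exact hne (h0.trans h0'.symm)
      · rw [h0, h0'] at heq
        simp only [if_true, Bool.false_eq_true, if_false] at heq
        have m1 := chi (Fin.tail ε); rw [heq] at m1
        exact hαγ ((descendN n p.lo (Fin.tail ε')).2.partner_eq m1 (clo (Fin.tail ε')))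
      · rw [h0, h0'] at heq
        simp only [if_true, Bool.false_eq_true, if_false] at heq
        have m1 := clo (Fin.tail ε); rw [heq] at m1
        exact hαγ ((descendN n p.hi (Fin.tail ε')).2.partner_eq (chi (Fin.tail ε')) m1)
      · exact hne (h0.trans h0'.symm)
    rw [key] at heq
    have htail : Fin.tail ε = Fin.tail ε' := by
      by_cases hb : ε' 0
      · rw [if_pos hb] at heq; exact descendN_injective n p.hi hhi heq
      · rw [if_neg hb] at heq; exact descendN_injective n p.lo hlo heq
    rw [← Fin.cons_self_tail ε, ← Fin.cons_self_tail ε', key, htail]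

/-- ★ **THE CLOSED FORM HAS AT MOST ONE TERM**: `basisW q p` is `0` or the coefficient `coefN ε` (a signed power of `τ`) of the unique descent word
from `p` ending at `q`. [cite: KhristoforovSmirnov2021, §2 Lemma 4, proof and Fig. 3 (arXiv v1 p. 4)] -/
theorem basisW_eq_zero_or_coefN (q : Pat₀ nm) (p : Pat nm) :
    basisW q p = 0 ∨ ∃ ε : Fin p.pdepth → Bool, descendN p.pdepth p ε = q.1 ∧ basisW q p = coefN p.pdepth ε := by
  classical
  by_cases hex : ∃ ε : Fin p.pdepth → Bool, descendN p.pdepth p ε = q.1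
  · obtain ⟨ε, hε⟩ := hex
    right
    refine ⟨ε, hε, ?_⟩
    rw [basisW_eq_sum_descendN, Finset.sum_eq_single ε]
    · rw [if_pos (congrArg Subtype.val hε)]
    · intro ε' _ hne
      rw [if_neg]
      intro e
      exact hne (descendN_injective p.pdepth p rfl ((Subtype.ext e).trans hε.symm))
    · intro hn; exact absurd (Finset.mem_univ _) hn
  · left
    rw [basisW_eq_sum_descendN]
    refine Finset.sum_eq_zero fun ε _ => ?_
    rw [if_neg]
    intro e
    exact hex ⟨ε, Subtype.ext e⟩

end WordInjective

end Literature.Probability.Percolation.MarkedLoops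

/-! # PART — BASIS-BVP (former HOME car ed.5 51464a6f): The home-arc boundary law of the tripod-law solution family

Topic `Literature/Probability/Percolation`; generic-`k` layer, sequel to `MarkedLoopTripodBasis.lean` (ALL solutions of the tripod law:
free data on the OUTERMOST patterns, `extend`, `solW`, `classWt`, the basis `basisW q = extend δ_q`; every solution a discretely holomorphic
class-weighted `k`-disorder observable; the fan = `−basisW (rainbow l)`) and `MarkedLoopFanBoundary.lean` (`false_of_chord_separates`: at a boundary mid-edge no link separates the mid-edge from its
partner — the tree's `MarkedLoopBoundarySupport` machinery). For the fan observable the tree/lane has a single-term boundary law on the arcs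
opposite to the apex (`gkW_fan_boundary`). Here: the analogue for EVERY member of the solution family on the HOME ARC.

* `false_of_encl_of_boundary` — at `z ∈ A_a` linked to `u_m`, no linked pair `(c, d)` has `c < m < d` with `z` outside the chord;
  `false_of_inside_of_boundary` — nor `z` inside the chord with `m` outside; ★★ `encl_iff_encl_gap_of_boundary` — THE ARC LAW: a linked pair
  of other corners encloses the partner iff it encloses the mid-edge (`c < m < d ↔ c ≤ a < d`): the link pattern of the `k+1` points
  `u_0, …, u_a, z, u_{a+1}, …` is non-crossing — the SUPPORT of the boundary values on every arc.
* ★ `depth_linkRel_eq_zero_of_boundary_last` — on the HOME ARC `A_{k−1}` (from the last corner `u_{k−1}` to `u_0`) the partner of every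
  configuration is enclosed by NO link: the (partner, link relation) of a boundary configuration there is OUTERMOST (depth `0`).
* ★★ `isPattern_linkRel` — THE (PARTNER, LINK RELATION) OF EVERY LOOP CONFIGURATION IS A PATTERN (`odd_component` + the tree's five-mark
  non-crossing lemma with the partner as fifth mark + class uniqueness); `gkW_congr_of_pattern` / `obsW_congr_of_pattern` /
  `obsW_classWt_restrictW` (the observable sees only the pattern values); `obsWLin`, `classWtLin` (linearity); ★★★ `obsW_eq_sum_outermost` —
  EVERY TRIPOD-LAW OBSERVABLE IS `Σ_{q : Pat₀ k} wt(q) · ObsW (classWt (basisW q))`: the `#NCMatching (k+1)` basis observables span them all.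
* ★★ `gkW_classWt_eq_sum_pattern`, `patternCount` (`N_p(z)`), ★★ `obsW_classWt_eq_sum_patternCount` — THE CLASS-WEIGHTED OBSERVABLE IS THE
  PATTERN-COUNT EXPANSION `Σ_p w p · N_p(z)` (a linear functional of the pattern law); ★ `patternCount_eq_zero_of_boundary` — the arc law in
  count form: on `A_a`, `N_p = 0` unless every chord of `p` encloses the partner iff it encloses the mid-edge.
* ★★ `gkW_basis_boundary_last` — THE HOME-ARC BOUNDARY LAW: at `z ∈ A_{k−1}` every configuration weighs `1` or `0` under
  `classWt (basisW q)`, according as it links `z` to `u_j` with link relation `L`, `(j, L) = q`; ★★ `obsW_basis_boundary_last` — so the basis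
  observable there is a natural number, the COUNT of configurations (both halves of the edge) realising the pattern `q`, i.e. (header remark)
  realising the link pattern `closeUp q` of the `k+1` points `u_0, …, u_{k−1}, z`. With `holomorphicW_extend` (tree/lane) this is a discrete
  Riemann–Hilbert datum for each of the `#NCMatching (k+1)` basis observables: holomorphic inside, a link-pattern count on the home arc.
  The `k`-mark, all-patterns analogue of Khristoforov–Smirnov's boundary values eq. (4) (`k = 3`, p. 5); for the fan (`q` = the rainbow)
  it is the lane's `gkW_fan_boundary` at `a = 2l` (tree/HOME `restrictW_fanWt_eq_neg_basisW`).

Not claimed: the VALUES on the other arcs (there the surviving patterns are exactly the ones outermost for the cut at `a` — the arc law — and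
`basisW q` takes its recursively determined values on them), any uniqueness / boundary-value PROBLEM statement, any continuum limit.

## References
* M. Khristoforov, S. Smirnov, *Percolation and O(1) loop model*, arXiv:2111.15612 (2021), §1.2 (arXiv v1 p. 2), §2 Definition 3 and
  Lemma 4 (p. 4), eq. (4) and Remark 6 (p. 5).
* B. Bollobás, O. Riordan, *Percolation*, CUP (2006), Ch. 7 §7.2.2 (pp. 191–195).
-/

open Finset

namespace Literature.Probability.Percolation.MarkedLoops

open Literature.Probability.Percolation Literature.Probability.LatticeModels
open Literature.Probability.Percolation.FivePoint (side xiDeg XiLinked tau)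
open Literature.Probability.Percolation.FivePoint.N5 (sideGraph xiLinked_iff_reachable)
open TriMarkedDomain

/-! ### The link pattern of a loop configuration is a pattern -/

section LinkRelPattern

variable {nm : ℕ} {D : TriMarkedDomain nm}

/-- ★★ **THE (PARTNER, LINK RELATION) OF EVERY LOOP CONFIGURATION IS A PATTERN**: in the XOR space at the `i`-th side of a face `v` with
three `H_G`-sides (odd endpoint `s ∈ {v, oppFace v i}` not a corner), a configuration linked to `u_j` has `linkRel` symmetric, irreflexive,
avoiding `j`, perfect on the other corners (each corner's strand ends at exactly one other corner — `odd_component`, all side counts `≤ 2`)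
and NON-CROSSING (the tree's `false_of_interleaved_links`, fifth mark `j`). Hence the class-weighted observable is a linear functional of
the PATTERN LAW of the configuration. [cite: KhristoforovSmirnov2021, §1.2 (arXiv v1 p. 2: «IP(ξ) is a union of disjoint paths, matching marked points»)] -/
theorem isPattern_linkRel {v : HexVertex} (hv : AllSides D v) {i : Fin 3} {s : HexVertex}
    (hs : s ∈ ({v, oppFace v i} : Finset HexVertex)) (hsc : s ∉ corners D) {ξ : Finset (Sym2 (Site 2))} (hξ : ξ ∈ TXb D v i s)
    {j : Fin nm} (hj : InClassX D (faceVertex v (i + 1)) (faceVertex v (i + 2)) s j ξ) : IsPattern j (linkRel D ξ) := by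
  classical
  obtain ⟨hξ', Y, hY, hlink⟩ := hj
  have hYj : Y = yc D j := eq_yc D hY
  subst hYj
  obtain ⟨hsub, hpar⟩ := (mem_TXb_iff (D := D) v i s ξ).1 hξ
  have hξh : ξ ⊆ hBonds D := fun b hb => Finset.mem_of_mem_erase (hsub hb)
  have hdeg : ∀ F, xiDeg ξ F ≤ 2 := xiDeg_le_two_of_mem_TXb D i hs hξ
  have hyc_odd : ∀ c : Fin nm, Odd (xiDeg ξ (yc D c)) := by
    intro c
    rw [hpar _ (yc_mem_touching D c), Finset.mem_symmDiff, Finset.mem_singleton]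
    left; exact ⟨yc_mem_corners D c, fun h => hsc (h ▸ yc_mem_corners D c)⟩
  -- an odd touching face is `s` or a corner
  have hodd_cases : ∀ F ∈ triFacesTouching D.verts, Odd (xiDeg ξ F) → F = s ∨ ∃ c, F = yc D c := by
    intro F hF hodd
    have h := (hpar F hF).1 hodd
    rw [Finset.mem_symmDiff, Finset.mem_singleton] at h
    rcases h with ⟨hc, -⟩ | ⟨hFs, -⟩
    · exact Or.inr ((mem_corners D).1 hc)
    · exact Or.inl hFs
  -- a corner linked to `s` is the partner
  have huniq : ∀ b : Fin nm, XiLinked ξ s (yc D b) → b = j := fun b hb =>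
    (existsUnique_inClassX D hv i hs hξ).unique ⟨hξ', yc D b, yc_spec D b, hb⟩ ⟨hξ', yc D j, hY, hlink⟩
  refine ⟨fun a b hab => ?_, fun a haa => ?_, fun a b hab => ?_, fun a ha => ?_, fun x y z w hxz hyw => ?_⟩
  · rw [mem_linkRel] at hab ⊢
    exact ⟨hab.1.symm, xiLinked_symm' hab.2⟩
  · exact (mem_linkRel.1 haa).1 rfl
  · rw [mem_linkRel] at hab
    intro e
    rw [e] at hab
    exact hab.1 (huniq b (xiLinked_trans' hlink hab.2)).symm
  · -- the strand from `y_a` ends at another odd face: a corner `y_b` (not `s`: that would make `a` the partner)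
    obtain ⟨⟨Y₂, hne, hodd, hreach⟩, huniq₂⟩ := odd_component D hξh hdeg (yc_mem_touching D a) (hyc_odd a)
    have hY₂t : Y₂ ∈ triFacesTouching D.verts := touching_of_reachable D hξh (yc_mem_touching D a) hreach
    rcases hodd_cases Y₂ hY₂t hodd with rfl | ⟨b, rfl⟩
    · exact absurd (huniq a (xiLinked_symm' ((xiLinked_iff_reachable _ _ _).2 hreach))) ha
    · have hab : a ≠ b := fun e => hne (by rw [e])
      refine ⟨b, mem_linkRel.2 ⟨hab, (xiLinked_iff_reachable _ _ _).2 hreach⟩, fun b' hb' => ?_⟩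
      have hb' : (a, b') ∈ linkRel D ξ := hb'
      rw [mem_linkRel] at hb'
      exact yc_injective D (huniq₂ _ _ ((xiLinked_iff_reachable _ _ _).1 hb'.2) hreach (hyc_odd b') hodd
        (fun e => hb'.1 (yc_injective D e).symm) hne)
  · -- non-crossing: the tree's five-mark lemma with the partner `j` as the fifth mark
    have offj : ∀ {a b : Fin nm}, (a, b) ∈ linkRel D ξ → j ≠ a := by
      intro a b hab e
      rw [mem_linkRel] at hab
      rw [← e] at hab
      exact hab.1 (huniq b (xiLinked_trans' hlink hab.2)).symm
    have hjx := offj hxz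
    have hjy := offj hyw
    have hjz := offj ((show (z, x) ∈ linkRel D ξ from by
      rw [mem_linkRel] at hxz ⊢; exact ⟨hxz.1.symm, xiLinked_symm' hxz.2⟩))
    have hjw := offj ((show (w, y) ∈ linkRel D ξ from by
      rw [mem_linkRel] at hyw ⊢; exact ⟨hyw.1.symm, xiLinked_symm' hyw.2⟩))
    rw [mem_linkRel] at hxz hyw
    exact fun hq => false_of_interleaved_links (D := D) hξh hdeg hq hjx hjy hjz hjw (hyc_odd x) (hyc_odd y) (hyc_odd z) (hyc_odd w)
      hxz.2 hyw.2

end LinkRelPattern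

section BasisBoundary

variable {nm : ℕ} {D : TriMarkedDomain nm}

/-- **no link encloses the partner of a boundary mid-edge lying outside it**: at `z ∈ A_a` linked to `u_m`, a linked pair `(c, d)` with
`c < m < d` cannot have `z` outside the chord (`d ≤ a` or `a < c`).
[cite: KhristoforovSmirnov2021, §1.2 (arXiv v1 p. 2: «disjoint paths») and §2 eq. (4) (p. 5)] -/
theorem false_of_encl_of_boundary {v : HexVertex} (hv : AllSides D v) {i : Fin 3} {s : HexVertex}
    (hs : s ∈ ({v, oppFace v i} : Finset HexVertex)) (hsc : s ∉ corners D) {g o : Site 2} (he : side v i = s(g, o))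
    {a : Fin nm} (hd : (g, o) ∈ D.stretch a) {ξ : Finset (Sym2 (Site 2))} (hξ : ξ ∈ TXb D v i s)
    {m c d : Fin nm} (hm : XiLinked ξ s (yc D m)) (hcd : (c, d) ∈ linkRel D ξ) (hc : c < m) (hmd : m < d)
    (hout : d ≤ a ∨ a < c) : False :=
  false_of_chord_separates hv hs hsc he hd hξ (c := d) (d := c) (m := m) (Or.inr (Or.inl ⟨hc, hmd⟩))
    (Or.inr ⟨hc.trans hmd, hout⟩) hm (xiLinked_symm' (mem_linkRel.1 hcd).2)

/-- **no link separates a boundary mid-edge inside it from a partner outside it**: at `z ∈ A_a` linked to `u_m`, a linked pair `(c, d)`,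
`c < d`, with `z` inside the chord (`c ≤ a < d`) cannot have `m` outside (`m < c` or `d < m`).
[cite: KhristoforovSmirnov2021, §1.2 (arXiv v1 p. 2: «disjoint paths») and §2 eq. (4) (p. 5)] -/
theorem false_of_inside_of_boundary {v : HexVertex} (hv : AllSides D v) {i : Fin 3} {s : HexVertex}
    (hs : s ∈ ({v, oppFace v i} : Finset HexVertex)) (hsc : s ∉ corners D) {g o : Site 2} (he : side v i = s(g, o))
    {a : Fin nm} (hd : (g, o) ∈ D.stretch a) {ξ : Finset (Sym2 (Site 2))} (hξ : ξ ∈ TXb D v i s)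
    {m c d : Fin nm} (hm : XiLinked ξ s (yc D m)) (hcd : (c, d) ∈ linkRel D ξ) (hlt : c < d) (hin : c ≤ a ∧ a < d)
    (hout : m < c ∨ d < m) : False := by
  rcases hout with h | h
  · exact false_of_chord_separates hv hs hsc he hd hξ (c := c) (d := d) (m := m) (Or.inr (Or.inr ⟨h, hlt⟩)) (Or.inl hin) hm
      (mem_linkRel.1 hcd).2
  · exact false_of_chord_separates hv hs hsc he hd hξ (c := c) (d := d) (m := m) (Or.inl ⟨hlt, h⟩) (Or.inl hin) hm
      (mem_linkRel.1 hcd).2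

/-- ★★ **THE ARC LAW (support of the boundary values)**: at a boundary mid-edge `z ∈ A_a` linked to `u_m`, a linked pair `(c, d)` of OTHER
corners (`c < d`, both `≠ m`) ENCLOSES THE PARTNER `m` IFF IT ENCLOSES THE MID-EDGE (`c ≤ a < d`): the link pattern of the `k + 1` points
`u_0, …, u_a, z, u_{a+1}, …, u_{k−1}` is non-crossing. (For a loop configuration the pairs of `linkRel` avoid the partner automatically — `s` is
the other end of `u_m`'s strand; the hypotheses `m ≠ c`, `m ≠ d` keep the statement free of that bookkeeping.) On the home arc `a = k − 1`
no pair encloses `z`, hence none encloses `m` (next theorem).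
[cite: KhristoforovSmirnov2021, §1.2 (arXiv v1 p. 2: «IP(ξ) is a union of disjoint paths, matching marked points») and §2 eq. (4) (p. 5)] -/
theorem encl_iff_encl_gap_of_boundary {v : HexVertex} (hv : AllSides D v) {i : Fin 3} {s : HexVertex}
    (hs : s ∈ ({v, oppFace v i} : Finset HexVertex)) (hsc : s ∉ corners D) {g o : Site 2} (he : side v i = s(g, o))
    {a : Fin nm} (hd : (g, o) ∈ D.stretch a) {ξ : Finset (Sym2 (Site 2))} (hξ : ξ ∈ TXb D v i s)
    {m c d : Fin nm} (hm : XiLinked ξ s (yc D m)) (hcd : (c, d) ∈ linkRel D ξ) (hlt : c < d) (hmc : m ≠ c) (hmd : m ≠ d) :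
    (c < m ∧ m < d) ↔ (c ≤ a ∧ a < d) := by
  constructor
  · intro h
    by_contra hna
    refine false_of_encl_of_boundary hv hs hsc he hd hξ hm hcd h.1 h.2 ?_
    rcases not_and_or.1 hna with h1 | h1
    · exact Or.inr (lt_of_not_ge h1)
    · exact Or.inl (le_of_not_gt h1)
  · intro h
    by_contra hna
    rcases lt_or_gt_of_ne hmc with h1 | h1
    · exact false_of_inside_of_boundary hv hs hsc he hd hξ hm hcd hlt h (Or.inl h1)
    · rcases lt_or_gt_of_ne hmd with h2 | h2
      · exact hna ⟨h1, h2⟩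
      · exact false_of_inside_of_boundary hv hs hsc he hd hξ hm hcd hlt h (Or.inr h2)

/-- ★ **on the HOME ARC the link pattern of every configuration is OUTERMOST**: at a boundary mid-edge `z ∈ A_{k−1}` (the arc from the last
corner to the first) linked to `u_m`, no linked pair encloses `m`: `depth m (linkRel ξ) = 0`.
[cite: KhristoforovSmirnov2021, §1.2 (arXiv v1 p. 2) and §2 eq. (4) (p. 5)] -/
theorem depth_linkRel_eq_zero_of_boundary_last {v : HexVertex} (hv : AllSides D v) {i : Fin 3} {s : HexVertex}
    (hs : s ∈ ({v, oppFace v i} : Finset HexVertex)) (hsc : s ∉ corners D) {g o : Site 2} (he : side v i = s(g, o))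
    {a : Fin nm} (ha : a.val + 1 = nm) (hd : (g, o) ∈ D.stretch a) {ξ : Finset (Sym2 (Site 2))} (hξ : ξ ∈ TXb D v i s)
    {m : Fin nm} (hm : XiLinked ξ s (yc D m)) : depth m (linkRel D ξ) = 0 := by
  rw [depth_eq_zero_iff]
  rintro ⟨c, d⟩ hcd ⟨hc, hmd⟩
  exact false_of_encl_of_boundary hv hs hsc he hd hξ hm hcd hc hmd (Or.inl (Fin.le_def.2 (by have := d.2; omega)))

/-- the basis weight of a configuration on the home arc: the indicator of the pattern `q`.
[cite: KhristoforovSmirnov2021, §2 Definition 3 (arXiv v1 p. 4) and eq. (4) (p. 5)] -/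
private theorem classWt_basisW_of_boundary_last (q : Pat₀ nm) {v : HexVertex} (hv : AllSides D v) {i : Fin 3} {s : HexVertex}
    (hs : s ∈ ({v, oppFace v i} : Finset HexVertex)) (hsc : s ∉ corners D) {g o : Site 2} (he : side v i = s(g, o))
    {a : Fin nm} (ha : a.val + 1 = nm) (hd : (g, o) ∈ D.stretch a) {ξ : Finset (Sym2 (Site 2))} (hξ : ξ ∈ TXb D v i s)
    {j : Fin nm} (hcl : InClassX D (faceVertex v (i + 1)) (faceVertex v (i + 2)) s j ξ) :
    classWt (basisW q) j (linkRel D ξ) = if (j, linkRel D ξ) = q.1.1 then 1 else 0 := by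
  obtain ⟨-, Y, hY, hlink⟩ := hcl
  rw [eq_yc D hY] at hlink
  have h0 := depth_linkRel_eq_zero_of_boundary_last hv hs hsc he ha hd hξ hlink
  unfold classWt
  by_cases hpat : IsPattern j (linkRel D ξ)
  · rw [dif_pos hpat]
    have h0' : Pat.pdepth (⟨(j, linkRel D ξ), hpat⟩ : Pat nm) = 0 := h0
    rw [basisW_of_zero _ _ h0']
  · rw [dif_neg hpat, if_neg]
    intro e
    apply hpat
    rw [Prod.ext_iff] at e
    obtain ⟨e1, e2⟩ := e
    simp only at e1 e2
    rw [e1, e2]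
    exact q.1.2

open Classical in
/-- ★★ **THE HOME-ARC BOUNDARY LAW OF THE BASIS OBSERVABLES**: at a boundary mid-edge `z ∈ A_{k−1}`, under the class weight of the basis
solution `basisW q` every configuration weighs `1` if it links `z` to `u_{q.j}` with link relation `q.L`, and `0` otherwise.
[cite: KhristoforovSmirnov2021, §2 eq. (4) and Remark 6 (arXiv v1 p. 5); Definition 3 (p. 4)] -/
theorem gkW_basis_boundary_last (q : Pat₀ nm) {v : HexVertex} (hv : AllSides D v) {i : Fin 3} {s : HexVertex}
    (hs : s ∈ ({v, oppFace v i} : Finset HexVertex)) (hsc : s ∉ corners D) {g o : Site 2} (he : side v i = s(g, o))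
    {a : Fin nm} (ha : a.val + 1 = nm) (hd : (g, o) ∈ D.stretch a) {ξ : Finset (Sym2 (Site 2))} (hξ : ξ ∈ TXb D v i s) :
    GkW (D := D) (classWt (basisW q)) v i s ξ =
      if InClassX D (faceVertex v (i + 1)) (faceVertex v (i + 2)) s q.1.1.1 ξ ∧ linkRel D ξ = q.1.1.2 then 1 else 0 := by
  classical
  unfold GkW
  rw [Finset.sum_eq_single q.1.1.1]
  · by_cases hc : InClassX D (faceVertex v (i + 1)) (faceVertex v (i + 2)) s q.1.1.1 ξ
    · rw [if_pos hc, classWt_basisW_of_boundary_last q hv hs hsc he ha hd hξ hc]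
      by_cases hL : linkRel D ξ = q.1.1.2
      · simp only [hc, hL, and_self, if_true]
      · have e1 : (q.1.1.1, linkRel D ξ) ≠ q.1.1 := fun e => hL (congrArg Prod.snd e)
        simp only [e1, hL, and_false, if_false]
    · simp only [hc, false_and, if_false]
  · intro j _ hj
    by_cases hcl : InClassX D (faceVertex v (i + 1)) (faceVertex v (i + 2)) s j ξ
    · rw [if_pos hcl, classWt_basisW_of_boundary_last q hv hs hsc he ha hd hξ hcl]
      have e1 : (j, linkRel D ξ) ≠ q.1.1 := fun e => hj (congrArg Prod.fst e)
      simp only [e1, if_false]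
    · simp only [hcl, if_false]
  · intro h; exact absurd (Finset.mem_univ _) h

open Classical in
/-- ★★ hence **on the home arc the basis observable is a COUNT**: `ObsW D (classWt (basisW q)) v i = N` with `N ∈ ℕ` the number of
configurations (over both halves of the edge) linking `z` to `u_{q.j}` with link relation `q.L` — for `k = 2l+1` marks and `q` the rainbow
this is the fan's single-term law at `a = 2l` (phase `1`). [cite: KhristoforovSmirnov2021, §2 eq. (4) and Remark 6 (arXiv v1 p. 5)] -/
theorem obsW_basis_boundary_last (q : Pat₀ nm) {v : HexVertex} (hv : AllSides D v) {i : Fin 3} (hvc : v ∉ corners D)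
    (hoc : oppFace v i ∉ corners D) {g o : Site 2} (he : side v i = s(g, o)) {a : Fin nm} (ha : a.val + 1 = nm)
    (hd : (g, o) ∈ D.stretch a) : ∃ N : ℕ, ObsW D (classWt (basisW q)) v i = N := by
  have key : ∀ s ∈ ({v, oppFace v i} : Finset HexVertex), s ∉ corners D →
      ∃ N : ℕ, ∑ ξ ∈ TXb D v i s, GkW (D := D) (classWt (basisW q)) v i s ξ = N := by
    intro s hs hsc
    refine ⟨#((TXb D v i s).filter fun ξ => InClassX D (faceVertex v (i + 1)) (faceVertex v (i + 2)) s q.1.1.1 ξ ∧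
      linkRel D ξ = q.1.1.2), ?_⟩
    rw [Finset.card_filter, Nat.cast_sum]
    refine Finset.sum_congr rfl fun ξ hξ => ?_
    rw [gkW_basis_boundary_last q hv hs hsc he ha hd hξ]
    split_ifs <;> simp
  obtain ⟨N₁, h₁⟩ := key v (by simp) hvc
  obtain ⟨N₂, h₂⟩ := key (oppFace v i) (by simp) hoc
  refine ⟨N₁ + N₂, ?_⟩
  unfold ObsW
  rw [h₁, h₂]
  push_cast
  ring

end BasisBoundary

/-! ### Decomposition: every tripod-law observable is the combination of the basis observables -/

section Decomposition

variable {nm : ℕ} {D : TriMarkedDomain nm}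

/-- **configurations see only the pattern values**: two class weights that agree on the patterns give every configuration the same weight
(the (partner, linkRel) of a configuration is a pattern). [cite: KhristoforovSmirnov2021, §2 Definition 3 (arXiv v1 p. 4); §1.2 (p. 2)] -/
theorem gkW_congr_of_pattern {wt wt' : Fin nm → Finset (Fin nm × Fin nm) → ℂ} (h : ∀ j L, IsPattern j L → wt j L = wt' j L)
    {v : HexVertex} (hv : AllSides D v) {i : Fin 3} {s : HexVertex} (hs : s ∈ ({v, oppFace v i} : Finset HexVertex))
    (hsc : s ∉ corners D) {ξ : Finset (Sym2 (Site 2))} (hξ : ξ ∈ TXb D v i s) :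
    GkW (D := D) wt v i s ξ = GkW (D := D) wt' v i s ξ := by
  classical
  unfold GkW
  refine Finset.sum_congr rfl fun j _ => ?_
  by_cases hc : InClassX D (faceVertex v (i + 1)) (faceVertex v (i + 2)) s j ξ
  · rw [if_pos hc, if_pos hc, h j _ (isPattern_linkRel hv hs hsc hξ hc)]
  · rw [if_neg hc, if_neg hc]

/-- hence the observables agree (both endpoints of the edge not corners). [cite: KhristoforovSmirnov2021, §2 Definition 3 (arXiv v1 p. 4)] -/
theorem obsW_congr_of_pattern {wt wt' : Fin nm → Finset (Fin nm × Fin nm) → ℂ} (h : ∀ j L, IsPattern j L → wt j L = wt' j L)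
    {v : HexVertex} (hv : AllSides D v) {i : Fin 3} (hvc : v ∉ corners D) (hoc : oppFace v i ∉ corners D) :
    ObsW D wt v i = ObsW D wt' v i := by
  unfold ObsW
  rw [Finset.sum_congr rfl fun ξ hξ => gkW_congr_of_pattern h hv (by simp) hvc hξ,
    Finset.sum_congr rfl fun ξ hξ => gkW_congr_of_pattern h hv (by simp) hoc hξ]

/-- in particular a class weight and the class weight of its restriction to the patterns have the same observable.
[cite: KhristoforovSmirnov2021, §2 Definition 3 (arXiv v1 p. 4)] -/
theorem obsW_classWt_restrictW (wt : Fin nm → Finset (Fin nm × Fin nm) → ℂ) {v : HexVertex} (hv : AllSides D v) {i : Fin 3}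
    (hvc : v ∉ corners D) (hoc : oppFace v i ∉ corners D) : ObsW D (classWt (restrictW wt)) v i = ObsW D wt v i :=
  obsW_congr_of_pattern (fun j L hP => by unfold classWt restrictW; rw [dif_pos hP]) hv hvc hoc

variable (D) in
/-- the observable at an edge, as a LINEAR functional of the class weight. [cite: KhristoforovSmirnov2021, §2 Definition 3 (arXiv v1 p. 4: `F(z) = E[H(ξ)]`)] -/
noncomputable def obsWLin (v : HexVertex) (i : Fin 3) : (Fin nm → Finset (Fin nm × Fin nm) → ℂ) →ₗ[ℂ] ℂ where
  toFun wt := ObsW D wt v i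
  map_add' wt wt' := by
    classical
    have h : ∀ (s : HexVertex) (ξ : Finset (Sym2 (Site 2))), GkW (D := D) (wt + wt') v i s ξ = GkW (D := D) wt v i s ξ + GkW (D := D) wt' v i s ξ := by
      intro s ξ
      unfold GkW
      rw [← Finset.sum_add_distrib]
      refine Finset.sum_congr rfl fun j _ => ?_
      split_ifs <;> simp
    unfold ObsW
    simp only [h, Finset.sum_add_distrib]
    ring
  map_smul' c wt := by
    classical
    have h : ∀ (s : HexVertex) (ξ : Finset (Sym2 (Site 2))), GkW (D := D) (c • wt) v i s ξ = c * GkW (D := D) wt v i s ξ := by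
      intro s ξ
      unfold GkW
      rw [Finset.mul_sum]
      refine Finset.sum_congr rfl fun j _ => ?_
      split_ifs <;> simp
    unfold ObsW
    simp only [h, ← Finset.mul_sum, RingHom.id_apply, smul_eq_mul]
    ring

/-- Auxiliary. [cite: KhristoforovSmirnov2021, §2 Definition 3 (arXiv v1 p. 4)] -/
theorem obsWLin_apply (v : HexVertex) (i : Fin 3) (wt : Fin nm → Finset (Fin nm × Fin nm) → ℂ) : obsWLin D v i wt = ObsW D wt v i := rfl

/-- the class weight of a pattern weight is LINEAR in the pattern weight. [cite: KhristoforovSmirnov2021, §2 Definition 3 (arXiv v1 p. 4)] -/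
noncomputable def classWtLin (nm : ℕ) : (Pat nm → ℂ) →ₗ[ℂ] (Fin nm → Finset (Fin nm × Fin nm) → ℂ) where
  toFun := classWt
  map_add' w w' := by
    funext j L
    unfold classWt
    by_cases h : IsPattern j L
    · simp only [dif_pos h, Pi.add_apply]
    · simp only [dif_neg h, Pi.add_apply, add_zero]
  map_smul' c w := by
    funext j L
    unfold classWt
    by_cases h : IsPattern j L
    · simp only [dif_pos h, Pi.smul_apply, smul_eq_mul, RingHom.id_apply]
    · simp only [dif_neg h, Pi.smul_apply, smul_eq_mul, mul_zero, RingHom.id_apply]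

/-- Auxiliary. [cite: KhristoforovSmirnov2021, §2 Definition 3 (arXiv v1 p. 4)] -/
theorem classWtLin_apply (w : Pat nm → ℂ) : classWtLin nm w = classWt w := rfl

/-- ★★★ **EVERY TRIPOD-LAW OBSERVABLE IS THE COMBINATION OF THE BASIS OBSERVABLES WEIGHTED BY THE OUTERMOST VALUES**: for a class weight
`wt` obeying the tripod law, at every edge of a face with three `H_G`-sides whose endpoints are not corners,
`ObsW D wt v i = Σ_{q : Pat₀ k} wt(q) · ObsW D (classWt (basisW q)) v i` — `#NCMatching (k+1)` basis observables, each discretely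
holomorphic (`holomorphicW_basisW`) with the home-arc count law (`obsW_basis_boundary_last`).
[cite: KhristoforovSmirnov2021, §2 Definition 3 and Lemma 4 (arXiv v1 p. 4); §1.2 (p. 2)] -/
theorem obsW_eq_sum_outermost {wt : Fin nm → Finset (Fin nm × Fin nm) → ℂ} (hT : TripodLaw wt) {v : HexVertex} (hv : AllSides D v)
    {i : Fin 3} (hvc : v ∉ corners D) (hoc : oppFace v i ∉ corners D) :
    ObsW D wt v i = ∑ q : Pat₀ nm, wt q.1.1.1 q.1.1.2 * ObsW D (classWt (basisW q)) v i := by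
  rw [← obsW_classWt_restrictW wt hv hvc hoc, eq_sum_basisW_of_mem_solW (tripodLaw_iff_restrict_mem_solW.1 hT),
    ← classWtLin_apply, map_sum, ← obsWLin_apply, map_sum]
  refine Finset.sum_congr rfl fun q _ => ?_
  rw [map_smul, map_smul, obsWLin_apply, classWtLin_apply, smul_eq_mul]
  rfl

end Decomposition

/-! ### The observable as a pattern-count expansion, and the support of the counts on the boundary -/

section PatternCounts

variable {nm : ℕ} {D : TriMarkedDomain nm}

open Classical in
/-- **the weight of a configuration is the pattern weight of its pattern**: under `classWt w`, a configuration at an admissible edge weighs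
`Σ_p [pattern ξ = p] · w p` (exactly one term). [cite: KhristoforovSmirnov2021, §2 Definition 3 (arXiv v1 p. 4); §1.2 (p. 2)] -/
theorem gkW_classWt_eq_sum_pattern (w : Pat nm → ℂ) {v : HexVertex} (hv : AllSides D v) {i : Fin 3} {s : HexVertex}
    (hs : s ∈ ({v, oppFace v i} : Finset HexVertex)) (hsc : s ∉ corners D) {ξ : Finset (Sym2 (Site 2))} (hξ : ξ ∈ TXb D v i s) :
    GkW (D := D) (classWt w) v i s ξ =
      ∑ p : Pat nm, if InClassX D (faceVertex v (i + 1)) (faceVertex v (i + 2)) s p.1.1 ξ ∧ linkRel D ξ = p.1.2 then w p else 0 := by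
  obtain ⟨j₀, hj₀, huniq⟩ := existsUnique_inClassX D hv i hs hξ
  have hpat : IsPattern j₀ (linkRel D ξ) := isPattern_linkRel hv hs hsc hξ hj₀
  set p₀ : Pat nm := ⟨(j₀, linkRel D ξ), hpat⟩ with hp₀
  -- left side: the single term `j₀`
  unfold GkW
  rw [Finset.sum_eq_single j₀, if_pos hj₀, Finset.sum_eq_single p₀, if_pos ⟨hj₀, rfl⟩]
  · unfold classWt
    rw [dif_pos hpat]
  · rintro p - hp
    rw [if_neg]
    rintro ⟨hc, hL⟩
    apply hp
    apply Subtype.ext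
    exact Prod.ext (huniq _ hc) hL.symm
  · intro h; exact absurd (Finset.mem_univ _) h
  · intro j _ hj
    rw [if_neg (fun h => hj (huniq j h))]
  · intro h; exact absurd (Finset.mem_univ _) h

variable (D) in
open Classical in
/-- **`N_p(z)`**: the number of configurations of the XOR space at the `i`-th side of `v` (both halves of the subdivided edge) whose
(partner, link relation) is the pattern `p`. [cite: KhristoforovSmirnov2021, §1.2 (arXiv v1 p. 2: «the law of the link pattern»)] -/
noncomputable def patternCount (v : HexVertex) (i : Fin 3) (p : Pat nm) : ℕ :=
  #((TXb D v i v).filter fun ξ => InClassX D (faceVertex v (i + 1)) (faceVertex v (i + 2)) v p.1.1 ξ ∧ linkRel D ξ = p.1.2) +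
    #((TXb D v i (oppFace v i)).filter fun ξ => InClassX D (faceVertex v (i + 1)) (faceVertex v (i + 2)) (oppFace v i) p.1.1 ξ ∧ linkRel D ξ = p.1.2)

open Classical in
/-- ★★ **THE CLASS-WEIGHTED OBSERVABLE IS THE PATTERN-COUNT EXPANSION**: `ObsW D (classWt w) v i = Σ_p w p · N_p` at every edge of a face with
three `H_G`-sides whose endpoints are not corners — the observable is a linear functional of the PATTERN LAW.
[cite: KhristoforovSmirnov2021, §2 Definition 3 (arXiv v1 p. 4: `F(z) = E[H(ξ)]`); §1.2 (p. 2: «the law of the link pattern»)] -/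
theorem obsW_classWt_eq_sum_patternCount (w : Pat nm → ℂ) {v : HexVertex} (hv : AllSides D v) {i : Fin 3} (hvc : v ∉ corners D)
    (hoc : oppFace v i ∉ corners D) : ObsW D (classWt w) v i = ∑ p : Pat nm, w p * (patternCount D v i p : ℂ) := by
  have key : ∀ s ∈ ({v, oppFace v i} : Finset HexVertex), s ∉ corners D →
      ∑ ξ ∈ TXb D v i s, GkW (D := D) (classWt w) v i s ξ =
        ∑ p : Pat nm, w p * #((TXb D v i s).filter fun ξ =>
          InClassX D (faceVertex v (i + 1)) (faceVertex v (i + 2)) s p.1.1 ξ ∧ linkRel D ξ = p.1.2) := by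
    intro s hs hsc
    rw [Finset.sum_congr rfl fun ξ hξ => gkW_classWt_eq_sum_pattern w hv hs hsc hξ, Finset.sum_comm]
    refine Finset.sum_congr rfl fun p _ => ?_
    rw [Finset.card_filter, Nat.cast_sum, Finset.mul_sum]
    refine Finset.sum_congr rfl fun ξ _ => ?_
    split_ifs <;> simp
  unfold ObsW patternCount
  rw [key v (by simp) hvc, key (oppFace v i) (by simp) hoc, ← Finset.sum_add_distrib]
  refine Finset.sum_congr rfl fun p _ => ?_
  push_cast
  ring

/-- ★ **SUPPORT OF THE COUNTS ON THE BOUNDARY (the arc law, count form)**: at a boundary mid-edge `z ∈ A_a`, a pattern `p` one of whose chords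
`(c, d)`, `c < d`, encloses the partner but not the mid-edge, or the mid-edge but not the partner, has `N_p(z) = 0`.
[cite: KhristoforovSmirnov2021, §1.2 (arXiv v1 p. 2) and §2 eq. (4) (p. 5)] -/
theorem patternCount_eq_zero_of_boundary {v : HexVertex} (hv : AllSides D v) {i : Fin 3} (hvc : v ∉ corners D) (hoc : oppFace v i ∉ corners D)
    {g o : Site 2} (he : side v i = s(g, o)) {a : Fin nm} (hd : (g, o) ∈ D.stretch a) (p : Pat nm) {c d : Fin nm}
    (hcd : (c, d) ∈ p.1.2) (hlt : c < d) (hsep : ¬ ((c < p.1.1 ∧ p.1.1 < d) ↔ (c ≤ a ∧ a < d))) : patternCount D v i p = 0 := by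
  classical
  have key : ∀ s ∈ ({v, oppFace v i} : Finset HexVertex), s ∉ corners D →
      #((TXb D v i s).filter fun ξ => InClassX D (faceVertex v (i + 1)) (faceVertex v (i + 2)) s p.1.1 ξ ∧ linkRel D ξ = p.1.2) = 0 := by
    intro s hs hsc
    rw [Finset.card_eq_zero, Finset.filter_eq_empty_iff]
    rintro ξ hξ ⟨hc, hL⟩
    obtain ⟨-, Y, hY, hlink⟩ := hc
    rw [eq_yc D hY] at hlink
    have hcd' : (c, d) ∈ linkRel D ξ := by rw [hL]; exact hcd
    exact hsep (encl_iff_encl_gap_of_boundary hv hs hsc he hd hξ hlink hcd' hlt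
      (fun e => (p.2.off c d hcd) e.symm) (fun e => (p.2.off₂ hcd) e.symm))
  unfold patternCount
  rw [key v (by simp) hvc, key (oppFace v i) (by simp) hoc]

end PatternCounts

end Literature.Probability.Percolation.MarkedLoops

/-! # PART — TRIPOD-K3 (former HOME car ed.1 af50b1e0): Worked example `k = 3`: Khristoforov–Smirnov's weight `τ^j` in the basis of the tripod-law solution space

Topic `Literature/Probability/Percolation`; generic-`k` layer, a rider on `MarkedLoopTripodBasis.lean`. For three marks the outermost patterns are
the RAINBOW `(0; {1,2})` and `q₂ = (2; {0,1})` (the third pattern `(1; {0,2})` has depth one), so `solW 3` is two-dimensional with basis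
`basisW (rainbow 1)`, `basisW q₂`; Khristoforov–Smirnov's weight `j ↦ τ^j` (Definition 3: `F = Σ_j τ^j H_j`; tree `tripodLaw_tau_pow`) is the
solution with outermost values `(1, τ²)`: on the patterns, `τ^j = basisW (rainbow 1) + τ²·basisW q₂` (`restrictW_tau_pow_eq`). Consistency /
illustration only; no new mathematics. [cite: KhristoforovSmirnov2021, §2 Definition 3 and Lemma 4 (arXiv v1 p. 4)]
-/

open Finset

namespace Literature.Probability.Percolation.MarkedLoops

open Literature.Probability.Percolation.FivePoint (tau)

/-- the relation `{0 ~ 1}` on three corners (both orientations). [cite: KhristoforovSmirnov2021, §1.2 (arXiv v1 p. 2)] -/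
def pair01 : Finset (Fin 3 × Fin 3) := {((0 : Fin 3), (1 : Fin 3)), ((1 : Fin 3), (0 : Fin 3))}

/-- `(2; {0 ~ 1})` is a pattern. [cite: KhristoforovSmirnov2021, §1.2 (arXiv v1 p. 2)] -/
theorem isPattern_two_pair01 : IsPattern (2 : Fin 3) pair01 := by
  refine ⟨?_, ?_, ?_, ?_, ?_⟩
  · unfold pair01; decide
  · unfold pair01; decide
  · unfold pair01; decide
  · intro a ha
    fin_cases a
    · exact ⟨1, by unfold pair01; decide, fun b hb => by fin_cases b <;> simp [pair01] at hb ⊢⟩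
    · exact ⟨0, by unfold pair01; decide, fun b hb => by fin_cases b <;> simp [pair01] at hb ⊢⟩
    · exact absurd rfl ha
  · unfold pair01 CcwQuad; decide

/-- it is outermost. [cite: KhristoforovSmirnov2021, §1.2 (arXiv v1 p. 2)] -/
theorem depth_two_pair01 : depth (2 : Fin 3) pair01 = 0 := by
  unfold depth pair01; decide

/-- the outermost pattern `q₂ = (2; {0 ~ 1})` of three corners. [cite: KhristoforovSmirnov2021, §1.2 (arXiv v1 p. 2)] -/
def q₂ : Pat₀ 3 := ⟨⟨((2 : Fin 3), pair01), isPattern_two_pair01⟩, depth_two_pair01⟩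

/-- on three corners a pattern's relation is the single chord on the two corners other than the partner.
[cite: KhristoforovSmirnov2021, §1.2 (arXiv v1 p. 2: «matching marked points»)] -/
theorem relation_eq_of_three {j : Fin 3} {L : Finset (Fin 3 × Fin 3)} (hP : IsPattern j L) :
    ∀ x y : Fin 3, (x, y) ∈ L ↔ (x ≠ j ∧ y ≠ j ∧ x ≠ y) := by
  intro x y
  constructor
  · intro h
    exact ⟨hP.off x y h, hP.off₂ h, hP.ne_of_mem h⟩
  · rintro ⟨hx, hy, hxy⟩
    obtain ⟨b, hb, -⟩ := hP.perfect x hx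
    have hbj : b ≠ j := hP.off₂ hb
    have hbx : b ≠ x := fun e => hP.ne_of_mem hb e.symm
    -- on `Fin 3`, the element other than `x` and `j` is unique
    have key : ∀ x y b j : Fin 3, x ≠ j → y ≠ j → x ≠ y → b ≠ j → b ≠ x → b = y := by decide
    rw [← key x y b j hx hy hxy hbj hbx]; exact hb

/-- ★ **the two outermost patterns of three corners**: the rainbow `(0; {1 ~ 2})` and `q₂ = (2; {0 ~ 1})`.
[cite: KhristoforovSmirnov2021, §1.2 (arXiv v1 p. 2)] -/
theorem pat₀_three (q : Pat₀ 3) : q = rainbow 1 ∨ q = q₂ := by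
  obtain ⟨⟨⟨j, L⟩, hP⟩, h0⟩ := q
  have hP' : IsPattern j L := hP
  have hrel := relation_eq_of_three hP'
  have h0' : depth j L = 0 := h0
  rw [depth_eq_zero_iff] at h0'
  -- the partner is `0` or `2`: for `j = 1` the chord `{0, 2}` encloses it
  fin_cases j
  · left
    apply Subtype.ext; apply Subtype.ext
    show (((0 : Fin 3), L) : Fin 3 × Finset (Fin 3 × Fin 3)) = ((⟨0, Nat.succ_pos _⟩ : Fin (2 * 1 + 1)), fanRel 1 0)
    refine Prod.ext rfl ?_
    show L = fanRel 1 0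
    ext ⟨x, y⟩
    rw [hrel x y, mem_fanRel]
    revert x y; decide
  · exfalso
    have hm : ((0 : Fin 3), (2 : Fin 3)) ∈ L := (hrel 0 2).2 (by decide)
    exact h0' _ hm (by decide)
  · right
    apply Subtype.ext; apply Subtype.ext
    show (((2 : Fin 3), L) : Fin 3 × Finset (Fin 3 × Fin 3)) = ((2 : Fin 3), pair01)
    refine Prod.ext rfl ?_
    show L = pair01
    ext ⟨x, y⟩
    rw [hrel x y]
    unfold pair01
    revert x y; decide

/-- ★★ **Khristoforov–Smirnov's weight in the basis**: on the patterns of three corners, `τ^j = basisW (rainbow 1) + τ²·basisW q₂` — the printed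
observable `F = Σ_j τ^j H_j` is the rainbow's basis observable plus `τ²` times that of `q₂`.
[cite: KhristoforovSmirnov2021, §2 Definition 3 and Lemma 4 (arXiv v1 p. 4)] -/
theorem restrictW_tau_pow_eq : restrictW (fun (j : Fin 3) _ => tau ^ (j : ℕ)) = basisW (rainbow 1) + tau ^ 2 • basisW q₂ := by
  have hL : restrictW (fun (j : Fin 3) _ => tau ^ (j : ℕ)) ∈ solW 3 := tripodLaw_iff_restrict_mem_solW.1 tripodLaw_tau_pow
  have hR : basisW (rainbow 1) + tau ^ 2 • basisW q₂ ∈ solW 3 :=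
    (solW 3).add_mem (basisW_mem_solW _) ((solW 3).smul_mem _ (basisW_mem_solW _))
  refine eq_of_mem_solW hL hR fun p hp => ?_
  rw [Pi.add_apply, Pi.smul_apply, smul_eq_mul, basisW_of_zero _ _ hp, basisW_of_zero _ _ hp]
  rcases pat₀_three ⟨p, hp⟩ with h | h
  · have h1 : p = (rainbow 1).1 := congrArg Subtype.val h
    rw [h1]
    have hne : (rainbow 1).1.1 ≠ q₂.1.1 := by decide
    rw [if_pos rfl, if_neg hne]
    show tau ^ ((⟨0, Nat.succ_pos _⟩ : Fin (2 * 1 + 1)) : ℕ) = _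
    simp
  · have h1 : p = q₂.1 := congrArg Subtype.val h
    rw [h1]
    have hne : q₂.1.1 ≠ (rainbow 1).1.1 := by decide
    rw [if_neg hne, if_pos rfl]
    show tau ^ ((2 : Fin 3) : ℕ) = _
    simp

end Literature.Probability.Percolation.MarkedLoops
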